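import Literature.Probability.RandomPlanarGeometry.HexSAWSurfaceWallRenewalSlackFourFourDownCount
import Literature.Probability.RandomPlanarGeometry.HexSAWSurfaceWallRenewalSlackFourFourDownHyp
import HarnessLib

/-!
# Hexagonal-lattice SAWs at a surface: slack four — the four-down blocks are the table walks, A11–A15

Wall-renewal blocks of the brick-wall (hexagonal) half-plane walk at slack four (`m = 6k + 4`, `k` visits) with four
down steps off the wall fall into the block families A7–A15 and B5 (`…SlackFourFourDownFamiliesDeep/Shallow`: the
table walks `s4a … s4j`), counted in `…SlackFourFourDownCount` (`ddddBlocks k`,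
`12·#ddddBlocks k = (k−2)(2k⁴ − 7k³ + 4k² + 7k + 6)`). The classification runs: runs (`…FourDownRuns`) ⇒ constraint
system (`…Hyp`, `…Systems`) ⇒ integer table (`…IntTable<order>`: the system holds iff its variables solve one of the
family systems) ⇒ THIS MODULE: a block whose variables solve the system of family A11, A12, A13, A14, A15 IS the
table walk of that family with the parameters read off the initial wall run `p` and the run lengths `h₁ … h₇`, and
lies in `ddddBlocks k`.

Per family: `<order>4_table_x` (a walk with the family's run velocities and step times agrees with the table
`s4xX/s4xY` up to time `6k + 4` — nine affine pieces, one `omega` each), `s4x_mem_ddddBlocks` (the family hypotheses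
place the table walk in the piece of the count it belongs to: explicit index point, the piece chosen by nested case
splits on the parameter ranges), `<order>4_eq_s4x` (the signs of the seven runs are forced by the family system
against the run end columns, the parities give the half variables; then the table lemma, `eq_tab_walk_of_forall` and
the membership lemma: the block lies in `ddddBlocks k` and is a table walk). The B5 membership lemma
`s4j_mem_ddddBlocks` is included for the `D D U U D D U U` chain.

STATUS: lane theorem of the a-idea-1 bridge/renewal lineage, car 99 «four-down identification» — step (v) of the
classification of the four-down stratum of the slack-four row (FINDING-HEX-WALL-SLACK-FOUR-LAW:
`12·#{#stepsD = 4} = (k−2)(2k⁴ − 7k³ + 4k² + 7k + 6)`); with the runs, systems and tables it gives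
`block ⇒ ∈ ddddBlocks k` for the four orders, and with the B5 chain and `ddddBlocks_subset` the law. OURS
(elementary). Sources: the renewal / irreducible-bridge structure [MS] Madras–Slade §4.2 (Definition 4.2.1, p. 90;
remark before (4.2.21), p. 94), the brick-wall frame [EJ] Enting–Jensen §7.4.2, Fig. 7.10 — neither contains this
identification.
-/

namespace Literature.Probability.RandomPlanarGeometry.SAW.HexBW.Wall

open Finset Filter Function
open Literature.Probability.LatticeModels Literature.Probability.Percolation SimpleGraph

variable {ω : ℕ → Site 2}

/-! ### §1  Index-set membership and the pieces of the count (plumbing) -/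
/-- Membership in the 5-simplex `hexIdx n` of `…SlackFourFourDownCount` (plumbing). [folklore] -/
private theorem mem_hexIdx_s {n : ℕ} {p : ℕ × ℕ × ℕ × ℕ × ℕ} :
    p ∈ hexIdx n ↔ p.1 + p.2.1 + p.2.2.1 + p.2.2.2.1 + p.2.2.2.2 < n := by
  simp only [hexIdx, mem_filter, mem_product, mem_range]
  omega

/-- Membership in the 4-simplex `pentIdx n` of `…SlackFourFourDownCount` (plumbing). [folklore] -/
private theorem mem_pentIdx_s {n : ℕ} {p : ℕ × ℕ × ℕ × ℕ} : p ∈ pentIdx n ↔ p.1 + p.2.1 + p.2.2.1 + p.2.2.2 < n :=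
    by
  simp only [pentIdx, mem_filter, mem_product, mem_range]
  omega

open Classical in
/-- Piece `a11a` of the count (`a11aImg` of `…SlackFourFourDownCount`): the `s4e` table walk with parameters of this
form, index point `(x₁, x₂, x₃, x₄, x₅)`, lies in `ddddBlocks k`. [folklore] -/
private theorem mem_dddd_a11a {k a i j d g : ℕ}
    (x1 x2 x3 x4 x5 : ℕ) (hx : x1 + x2 + x3 + x4 + x5 + 4 ≤ k) (h1 : x2 + 1 = a) (h2 : x2 + x3 = i) (h3 : x4 = j)
    (h4 : x5 = d) (h5 : x1 = g) :
    s4e k a i j d g ∈ ddddBlocks k := by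
  subst h1 h2 h3 h4 h5
  have hm : _ ∈ a11aImg k := Finset.mem_image.2 ⟨(x1, x2, x3, x4, x5), mem_hexIdx_s.2 (by simp only; omega), rfl⟩
  simp only [ddddBlocks, a7Img, a8Img, a9Img, a11Img, a13Img, Finset.mem_union]
  exact Or.inl <| Or.inl <| Or.inl <| Or.inl <| Or.inl <| Or.inr <| Or.inl <| Or.inl <| Or.inl <| hm

open Classical in
/-- Piece `a11b` of the count (`a11bImg` of `…SlackFourFourDownCount`): the `s4e` table walk with parameters of this
form, index point `(x₁, x₂, x₃, x₄, x₅)`, lies in `ddddBlocks k`. [folklore] -/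
private theorem mem_dddd_a11b {k a i j d g : ℕ}
    (x1 x2 x3 x4 x5 : ℕ) (hx : x1 + x2 + x3 + x4 + x5 + 4 ≤ k) (h1 : x2 + x3 + 2 = a) (h2 : x2 = i) (h3 : x3 + x4 = j)
    (h4 : x5 = d) (h5 : x1 = g) :
    s4e k a i j d g ∈ ddddBlocks k := by
  subst h1 h2 h3 h4 h5
  have hm : _ ∈ a11bImg k := Finset.mem_image.2 ⟨(x1, x2, x3, x4, x5), mem_hexIdx_s.2 (by simp only; omega), rfl⟩
  simp only [ddddBlocks, a7Img, a8Img, a9Img, a11Img, a13Img, Finset.mem_union]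
  exact Or.inl <| Or.inl <| Or.inl <| Or.inl <| Or.inl <| Or.inr <| Or.inl <| Or.inl <| Or.inr <| hm

open Classical in
/-- Piece `a11c` of the count (`a11cImg` of `…SlackFourFourDownCount`): the `s4e` table walk with parameters of this
form, index point `(x₁, x₂, x₃, x₄, x₅)`, lies in `ddddBlocks k`. [folklore] -/
private theorem mem_dddd_a11c {k a i j d g : ℕ}
    (x1 x2 x3 x4 x5 : ℕ) (hx : x1 + x2 + x3 + x4 + x5 + 5 ≤ k) (h1 : x2 + x3 + x4 + x5 + 3 = a) (h2 : x2 = i)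
    (h3 : x3 = j) (h4 : x4 = d) (h5 : x1 = g) :
    s4e k a i j d g ∈ ddddBlocks k := by
  subst h1 h2 h3 h4 h5
  have hm : _ ∈ a11cImg k := Finset.mem_image.2 ⟨(x1, x2, x3, x4, x5), mem_hexIdx_s.2 (by simp only; omega), rfl⟩
  simp only [ddddBlocks, a7Img, a8Img, a9Img, a11Img, a13Img, Finset.mem_union]
  exact Or.inl <| Or.inl <| Or.inl <| Or.inl <| Or.inl <| Or.inr <| Or.inl <| Or.inr <| hm

open Classical in
/-- Piece `a11d` of the count (`a11dImg` of `…SlackFourFourDownCount`): the `s4e` table walk with parameters of this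
form, index point `(x₁, x₂, x₃, x₄, x₅)`, lies in `ddddBlocks k`. [folklore] -/
private theorem mem_dddd_a11d {k a i j d g : ℕ}
    (x1 x2 x3 x4 x5 : ℕ) (hx : x1 + x2 + x3 + x4 + x5 + 5 ≤ k) (h1 : x2 + x3 + x4 + 3 = a) (h2 : x2 = i) (h3 : x3 = j)
    (h4 : x4 + x5 + 1 = d) (h5 : x1 = g) :
    s4e k a i j d g ∈ ddddBlocks k := by
  subst h1 h2 h3 h4 h5
  have hm : _ ∈ a11dImg k := Finset.mem_image.2 ⟨(x1, x2, x3, x4, x5), mem_hexIdx_s.2 (by simp only; omega), rfl⟩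
  simp only [ddddBlocks, a7Img, a8Img, a9Img, a11Img, a13Img, Finset.mem_union]
  exact Or.inl <| Or.inl <| Or.inl <| Or.inl <| Or.inl <| Or.inr <| Or.inr <| hm

open Classical in
/-- Piece `a12` of the count (`a12Img` of `…SlackFourFourDownCount`): the `s4f` table walk with parameters of this
form, index point `(x₁, x₂, x₃, x₄)`, lies in `ddddBlocks k`. [folklore] -/
private theorem mem_dddd_a12 {k i j d g : ℕ}
    (x1 x2 x3 x4 : ℕ) (hx : x1 + x2 + x3 + x4 + 5 ≤ k) (h1 : x1 = i) (h2 : x2 = j) (h3 : x3 = d) (h4 : x4 = g) :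
    s4f k i j d g ∈ ddddBlocks k := by
  subst h1 h2 h3 h4
  have hm : _ ∈ a12Img k := Finset.mem_image.2 ⟨(x1, x2, x3, x4), mem_pentIdx_s.2 (by simp only; omega), rfl⟩
  simp only [ddddBlocks, a7Img, a8Img, a9Img, a11Img, a13Img, Finset.mem_union]
  exact Or.inl <| Or.inl <| Or.inl <| Or.inl <| Or.inr <| hm

open Classical in
/-- Piece `a13a` of the count (`a13aImg` of `…SlackFourFourDownCount`): the `s4g` table walk with parameters of this
form, index point `(x₁, x₂, x₃, x₄, x₅)`, lies in `ddddBlocks k`. [folklore] -/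
private theorem mem_dddd_a13a {k a i d e g : ℕ}
    (x1 x2 x3 x4 x5 : ℕ) (hx : x1 + x2 + x3 + x4 + x5 + 5 ≤ k) (h1 : x1 + 1 = a) (h2 : x1 + x2 + 1 = i) (h3 : x3 = d)
    (h4 : x4 = e) (h5 : x5 = g) :
    s4g k a i d e g ∈ ddddBlocks k := by
  subst h1 h2 h3 h4 h5
  have hm : _ ∈ a13aImg k := Finset.mem_image.2 ⟨(x1, x2, x3, x4, x5), mem_hexIdx_s.2 (by simp only; omega), rfl⟩
  simp only [ddddBlocks, a7Img, a8Img, a9Img, a11Img, a13Img, Finset.mem_union]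
  exact Or.inl <| Or.inl <| Or.inl <| Or.inr <| Or.inl <| hm

open Classical in
/-- Piece `a13b` of the count (`a13bImg` of `…SlackFourFourDownCount`): the `s4g` table walk with parameters of this
form, index point `(x₁, x₂, x₃, x₄, x₅)`, lies in `ddddBlocks k`. [folklore] -/
private theorem mem_dddd_a13b {k a i d e g : ℕ}
    (x1 x2 x3 x4 x5 : ℕ) (hx : x1 + x2 + x3 + x4 + x5 + 5 ≤ k) (h1 : x1 + x2 + 1 = a) (h2 : x1 = i) (h3 : x3 = d)
    (h4 : x4 = e) (h5 : x5 = g) :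
    s4g k a i d e g ∈ ddddBlocks k := by
  subst h1 h2 h3 h4 h5
  have hm : _ ∈ a13bImg k := Finset.mem_image.2 ⟨(x1, x2, x3, x4, x5), mem_hexIdx_s.2 (by simp only; omega), rfl⟩
  simp only [ddddBlocks, a7Img, a8Img, a9Img, a11Img, a13Img, Finset.mem_union]
  exact Or.inl <| Or.inl <| Or.inl <| Or.inr <| Or.inr <| hm

open Classical in
/-- Piece `a14` of the count (`a14Img` of `…SlackFourFourDownCount`): the `s4h` table walk with parameters of this
form, index point `(x₁, x₂, x₃, x₄, x₅)`, lies in `ddddBlocks k`. [folklore] -/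
private theorem mem_dddd_a14 {k a i j d g : ℕ}
    (x1 x2 x3 x4 x5 : ℕ) (hx : x1 + x2 + x3 + x4 + x5 + 5 ≤ k) (h1 : x1 + x2 + x3 + x4 + 3 = a) (h2 : x2 = i)
    (h3 : x3 = j) (h4 : x1 = d) (h5 : x5 = g) :
    s4h k a i j d g ∈ ddddBlocks k := by
  subst h1 h2 h3 h4 h5
  have hm : _ ∈ a14Img k := Finset.mem_image.2 ⟨(x1, x2, x3, x4, x5), mem_hexIdx_s.2 (by simp only; omega), rfl⟩
  simp only [ddddBlocks, a7Img, a8Img, a9Img, a11Img, a13Img, Finset.mem_union]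
  exact Or.inl <| Or.inl <| Or.inr <| hm

open Classical in
/-- Piece `a15` of the count (`a15Img` of `…SlackFourFourDownCount`): the `s4i` table walk with parameters of this
form, index point `(x₁, x₂, x₃, x₄)`, lies in `ddddBlocks k`. [folklore] -/
private theorem mem_dddd_a15 {k i j d g : ℕ}
    (x1 x2 x3 x4 : ℕ) (hx : x1 + x2 + x3 + x4 + 4 ≤ k) (h1 : x2 + x3 = i) (h2 : x4 = j) (h3 : x1 = d) (h4 : x2 = g) :
    s4i k i j d g ∈ ddddBlocks k := by
  subst h1 h2 h3 h4
  have hm : _ ∈ a15Img k := Finset.mem_image.2 ⟨(x1, x2, x3, x4), mem_pentIdx_s.2 (by simp only; omega), rfl⟩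
  simp only [ddddBlocks, a7Img, a8Img, a9Img, a11Img, a13Img, Finset.mem_union]
  exact Or.inl <| Or.inr <| hm

open Classical in
/-- Piece `b5` of the count (`b5Img` of `…SlackFourFourDownCount`): the `s4j` table walk with parameters of this
form, index point `(x₁)`, lies in `ddddBlocks k`. [folklore] -/
private theorem mem_dddd_b5 {k a : ℕ}
    (x1 : ℕ) (hx : x1 + 3 ≤ k) (h1 : x1 + 1 = a) :
    s4j k a ∈ ddddBlocks k := by
  subst h1
  have hm : _ ∈ b5Img k := Finset.mem_image.2 ⟨x1, Finset.mem_range.2 (by omega), rfl⟩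
  simp only [ddddBlocks, a7Img, a8Img, a9Img, a11Img, a13Img, Finset.mem_union]
  exact Or.inr <| hm

/-! ### §2  The table walks of the families lie in `ddddBlocks k` -/
/-- **The A11 table walks lie in `ddddBlocks k`** (`…SlackFourFourDownCount`): under the family hypotheses of
`s4e_facts`, the piece among `a11aImg`, `a11bImg`, `a11cImg`, `a11dImg` is selected by the ranges of the parameters,
as in the count; the index point is explicit. [cite: MadrasSlade1993, §4.2, Definition 4.2.1 (p. 90)]
[cite: EntingJensen2009, §7.4.2, Fig. 7.10] -/
theorem s4e_mem_ddddBlocks {k a i j d g : ℕ}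
    (hF1 : 1 ≤ a) (hF2 : i + j + d + g + 4 ≤ k) (hF3 : a + g + 2 ≤ k) :
    s4e k a i j d g ∈ ddddBlocks k := by
  by_cases g1 : a ≤ i + 1
  · exact mem_dddd_a11a g (a - 1) (i + 1 - a) j d (by omega) (by omega) (by omega) (by omega) (by omega) (by omega)
  · by_cases g2 : a ≤ i + j + 2
    · exact mem_dddd_a11b g i (a - (i + 2)) (i + j + 2 - a) d (by omega) (by omega) (by omega) (by omega) (by omega)
          (by omega)
    · by_cases g3 : i + j + d + 3 ≤ a
      · exact mem_dddd_a11c g i j d (a - (i + j + d + 3)) (by omega) (by omega) (by omega) (by omega) (by omega)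
            (by omega)
      · exact mem_dddd_a11d g i j (a - (i + j + 3)) (i + j + d + 2 - a) (by omega) (by omega) (by omega) (by omega)
            (by omega) (by omega)

/-- **The A12 table walks lie in `ddddBlocks k`** (`…SlackFourFourDownCount`): under the family hypotheses of
`s4f_facts`, through `a12Img`; the index point is explicit. [cite: MadrasSlade1993, §4.2, Definition 4.2.1 (p. 90)]
[cite: EntingJensen2009, §7.4.2, Fig. 7.10] -/
theorem s4f_mem_ddddBlocks {k i j d g : ℕ}
    (hF1 : i + j + d + g + 5 ≤ k) :
    s4f k i j d g ∈ ddddBlocks k := by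
  exact mem_dddd_a12 i j d g (by omega) (by omega) (by omega) (by omega) (by omega)

/-- **The A13 table walks lie in `ddddBlocks k`** (`…SlackFourFourDownCount`): under the family hypotheses of
`s4g_facts`, the piece among `a13aImg`, `a13bImg` is selected by the ranges of the parameters, as in the count; the
index point is explicit. [cite: MadrasSlade1993, §4.2, Definition 4.2.1 (p. 90)]
[cite: EntingJensen2009, §7.4.2, Fig. 7.10] -/
theorem s4g_mem_ddddBlocks {k a i d e g : ℕ}
    (hF1 : 1 ≤ a) (hF2 : a + d + e + g + 4 ≤ k) (hF3 : i + d + e + g + 4 ≤ k) :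
    s4g k a i d e g ∈ ddddBlocks k := by
  by_cases g1 : a ≤ i
  · exact mem_dddd_a13a (a - 1) (i - a) d e g (by omega) (by omega) (by omega) (by omega) (by omega) (by omega)
  · exact mem_dddd_a13b i (a - (i + 1)) d e g (by omega) (by omega) (by omega) (by omega) (by omega) (by omega)

/-- **The A14 table walks lie in `ddddBlocks k`** (`…SlackFourFourDownCount`): under the family hypotheses of
`s4h_facts`, through `a14Img`; the index point is explicit. [cite: MadrasSlade1993, §4.2, Definition 4.2.1 (p. 90)]
[cite: EntingJensen2009, §7.4.2, Fig. 7.10] -/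
theorem s4h_mem_ddddBlocks {k a i j d g : ℕ}
    (hF1 : i + j + d + 3 ≤ a) (hF2 : a + g + 2 ≤ k) :
    s4h k a i j d g ∈ ddddBlocks k := by
  exact mem_dddd_a14 d i j (a - (i + j + d + 3)) g (by omega) (by omega) (by omega) (by omega) (by omega) (by omega)

/-- **The A15 table walks lie in `ddddBlocks k`** (`…SlackFourFourDownCount`): under the family hypotheses of
`s4i_facts`, through `a15Img`; the index point is explicit. [cite: MadrasSlade1993, §4.2, Definition 4.2.1 (p. 90)]
[cite: EntingJensen2009, §7.4.2, Fig. 7.10] -/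
theorem s4i_mem_ddddBlocks {k i j d g : ℕ}
    (hF1 : i + j + d + 4 ≤ k) (hF2 : g ≤ i) :
    s4i k i j d g ∈ ddddBlocks k := by
  exact mem_dddd_a15 d g (i - g) j (by omega) (by omega) (by omega) (by omega) (by omega)

/-- **The B5 table walks lie in `ddddBlocks k`** (`…SlackFourFourDownCount`): under the family hypotheses of
`s4j_facts`, through `b5Img`; the index point is explicit. [cite: MadrasSlade1993, §4.2, Definition 4.2.1 (p. 90)]
[cite: EntingJensen2009, §7.4.2, Fig. 7.10] -/
theorem s4j_mem_ddddBlocks {k a : ℕ}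
    (hF1 : 1 ≤ a) (hF2 : a + 2 ≤ k) :
    s4j k a ∈ ddddBlocks k := by
  exact mem_dddd_b5 (a - 1) (by omega) (by omega)

/-! ### §3  The table lemmas: runs with the family's velocities and step times give the table walk -/
/-- **Family A11 identified**: a walk whose initial wall run is `0 … p`, whose seven body runs have the velocities
of family A11 (`L R R R R L L` on the rows `−1, −2, −3, −2, −3, −2, −1`) and whose vertical steps fall at the step
times of the table walk `s4e k a i j d g` coincides with it up to time `6k + 4` (four-down analogue of
`ddduuu4_table_a` of `…SlackFourThreeDownLaw`). [cite: MadrasSlade1993, §4.2, Definition 4.2.1 (p. 90)]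
[cite: EntingJensen2009, §7.4.2, Fig. 7.10] -/
theorem ddduduuu4_table_e {k p t₂ t₃ t₄ t₅ t₆ t₇ t₈ a i j d g : ℕ}
    (hF1 : 1 ≤ a) (hF2 : i + j + d + g + 4 ≤ k) (hF3 : a + g + 2 ≤ k) (hR0 : ∀ i, i ≤ p → ω i 0 = i ∧ ω i 1 = 0)
    (hrun1 : ∀ i, p + 1 ≤ i → i ≤ t₂ → ω i 0 = p + (-1) * ((i - (p + 1) : ℕ) : ℤ) ∧ ω i 1 = -1)
    (hrun2 : ∀ i, t₂ + 1 ≤ i → i ≤ t₃ → ω i 0 = ω t₂ 0 + 1 * ((i - (t₂ + 1) : ℕ) : ℤ) ∧ ω i 1 = -2)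
    (hrun3 : ∀ i, t₃ + 1 ≤ i → i ≤ t₄ → ω i 0 = ω t₃ 0 + 1 * ((i - (t₃ + 1) : ℕ) : ℤ) ∧ ω i 1 = -3)
    (hrun4 : ∀ i, t₄ + 1 ≤ i → i ≤ t₅ → ω i 0 = ω t₄ 0 + 1 * ((i - (t₄ + 1) : ℕ) : ℤ) ∧ ω i 1 = -2)
    (hrun5 : ∀ i, t₅ + 1 ≤ i → i ≤ t₆ → ω i 0 = ω t₅ 0 + 1 * ((i - (t₅ + 1) : ℕ) : ℤ) ∧ ω i 1 = -3)
    (hrun6 : ∀ i, t₆ + 1 ≤ i → i ≤ t₇ → ω i 0 = ω t₆ 0 + (-1) * ((i - (t₆ + 1) : ℕ) : ℤ) ∧ ω i 1 = -2)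
    (hrun7 : ∀ i, t₇ + 1 ≤ i → i ≤ t₈ → ω i 0 = ω t₇ 0 + (-1) * ((i - (t₇ + 1) : ℕ) : ℤ) ∧ ω i 1 = -1)
    (hR8 : ∀ j, t₈ + 1 ≤ j → j ≤ 6 * k + 4 → ω j 0 = ω t₈ 0 + ((j - (t₈ + 1) : ℕ) : ℤ) ∧ ω j 1 = 0)
    (hpe : p = 2 * a + 1) (ht2e : t₂ = 4 * a + 1) (ht3e : t₃ = 4 * a + 2 * i + 3)
    (ht4e : t₄ = 4 * a + 2 * i + 2 * j + 6) (ht5e : t₅ = 4 * a + 2 * i + 2 * j + 2 * d + 9)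
    (ht6e : t₆ = 2 * k + 4 * a + 4) (ht7e : t₇ = 2 * k + 4 * a + 2 * g + 6) (ht8e : t₈ = 4 * k + 2 * a + 4) :
    ∀ t, t ≤ 6 * k + 4 → ω t 0 = s4eX k a i j d g t ∧ ω t 1 = s4eY k a i j d g t := by
  have hc1 := (hrun1 t₂ (by omega) le_rfl).1
  have hc2 := (hrun2 t₃ (by omega) le_rfl).1
  have hc3 := (hrun3 t₄ (by omega) le_rfl).1
  have hc4 := (hrun4 t₅ (by omega) le_rfl).1
  have hc5 := (hrun5 t₆ (by omega) le_rfl).1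
  have hc6 := (hrun6 t₇ (by omega) le_rfl).1
  have hc7 := (hrun7 t₈ (by omega) le_rfl).1
  intro t ht
  simp only [s4eX, s4eY]
  rcases Nat.lt_or_ge t (p + 1) with h1 | h1
  · obtain ⟨hx, hy⟩ := hR0 t (by omega)
    clear hR0 hrun1 hrun2 hrun3 hrun4 hrun5 hrun6 hrun7 hR8
    have hk1 : t ≤ 2 * a + 1 := by omega
    rw [hx, hy, if_pos hk1, if_pos hk1]
    constructor <;> omega
  rcases Nat.lt_or_ge t (t₂ + 1) with h2 | h2
  · obtain ⟨hx, hy⟩ := hrun1 t h1 (by omega)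
    clear hR0 hrun1 hrun2 hrun3 hrun4 hrun5 hrun6 hrun7 hR8
    have hk1 : ¬ (t ≤ 2 * a + 1) := by omega
    have hk2 : t ≤ 4 * a + 1 := by omega
    rw [hx, hy, if_neg hk1, if_neg hk1, if_pos hk2, if_pos hk2]
    constructor <;> omega
  rcases Nat.lt_or_ge t (t₃ + 1) with h3 | h3
  · obtain ⟨hx, hy⟩ := hrun2 t h2 (by omega)
    clear hR0 hrun1 hrun2 hrun3 hrun4 hrun5 hrun6 hrun7 hR8
    have hk1 : ¬ (t ≤ 2 * a + 1) := by omega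
    have hk2 : ¬ (t ≤ 4 * a + 1) := by omega
    have hk3 : t ≤ 4 * a + 2 * i + 3 := by omega
    rw [hx, hy, if_neg hk1, if_neg hk1, if_neg hk2, if_neg hk2, if_pos hk3, if_pos hk3]
    constructor <;> omega
  rcases Nat.lt_or_ge t (t₄ + 1) with h4 | h4
  · obtain ⟨hx, hy⟩ := hrun3 t h3 (by omega)
    clear hR0 hrun1 hrun2 hrun3 hrun4 hrun5 hrun6 hrun7 hR8
    have hk1 : ¬ (t ≤ 2 * a + 1) := by omega
    have hk2 : ¬ (t ≤ 4 * a + 1) := by omega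
    have hk3 : ¬ (t ≤ 4 * a + 2 * i + 3) := by omega
    have hk4 : t ≤ 4 * a + 2 * i + 2 * j + 6 := by omega
    rw [hx, hy, if_neg hk1, if_neg hk1, if_neg hk2, if_neg hk2, if_neg hk3, if_neg hk3, if_pos hk4, if_pos hk4]
    constructor <;> omega
  rcases Nat.lt_or_ge t (t₅ + 1) with h5 | h5
  · obtain ⟨hx, hy⟩ := hrun4 t h4 (by omega)
    clear hR0 hrun1 hrun2 hrun3 hrun4 hrun5 hrun6 hrun7 hR8
    have hk1 : ¬ (t ≤ 2 * a + 1) := by omega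
    have hk2 : ¬ (t ≤ 4 * a + 1) := by omega
    have hk3 : ¬ (t ≤ 4 * a + 2 * i + 3) := by omega
    have hk4 : ¬ (t ≤ 4 * a + 2 * i + 2 * j + 6) := by omega
    have hk5 : t ≤ 4 * a + 2 * i + 2 * j + 2 * d + 9 := by omega
    rw [hx, hy, if_neg hk1, if_neg hk1, if_neg hk2, if_neg hk2, if_neg hk3, if_neg hk3, if_neg hk4, if_neg hk4,
        if_pos hk5, if_pos hk5]
    constructor <;> omega
  rcases Nat.lt_or_ge t (t₆ + 1) with h6 | h6
  · obtain ⟨hx, hy⟩ := hrun5 t h5 (by omega)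
    clear hR0 hrun1 hrun2 hrun3 hrun4 hrun5 hrun6 hrun7 hR8
    have hk1 : ¬ (t ≤ 2 * a + 1) := by omega
    have hk2 : ¬ (t ≤ 4 * a + 1) := by omega
    have hk3 : ¬ (t ≤ 4 * a + 2 * i + 3) := by omega
    have hk4 : ¬ (t ≤ 4 * a + 2 * i + 2 * j + 6) := by omega
    have hk5 : ¬ (t ≤ 4 * a + 2 * i + 2 * j + 2 * d + 9) := by omega
    have hk6 : t ≤ 2 * k + 4 * a + 4 := by omega
    rw [hx, hy, if_neg hk1, if_neg hk1, if_neg hk2, if_neg hk2, if_neg hk3, if_neg hk3, if_neg hk4, if_neg hk4,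
        if_neg hk5, if_neg hk5, if_pos hk6, if_pos hk6]
    constructor <;> omega
  rcases Nat.lt_or_ge t (t₇ + 1) with h7 | h7
  · obtain ⟨hx, hy⟩ := hrun6 t h6 (by omega)
    clear hR0 hrun1 hrun2 hrun3 hrun4 hrun5 hrun6 hrun7 hR8
    have hk1 : ¬ (t ≤ 2 * a + 1) := by omega
    have hk2 : ¬ (t ≤ 4 * a + 1) := by omega
    have hk3 : ¬ (t ≤ 4 * a + 2 * i + 3) := by omega
    have hk4 : ¬ (t ≤ 4 * a + 2 * i + 2 * j + 6) := by omega
    have hk5 : ¬ (t ≤ 4 * a + 2 * i + 2 * j + 2 * d + 9) := by omega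
    have hk6 : ¬ (t ≤ 2 * k + 4 * a + 4) := by omega
    have hk7 : t ≤ 2 * k + 4 * a + 2 * g + 6 := by omega
    rw [hx, hy, if_neg hk1, if_neg hk1, if_neg hk2, if_neg hk2, if_neg hk3, if_neg hk3, if_neg hk4, if_neg hk4,
        if_neg hk5, if_neg hk5, if_neg hk6, if_neg hk6, if_pos hk7, if_pos hk7]
    constructor <;> omega
  rcases Nat.lt_or_ge t (t₈ + 1) with h8 | h8
  · obtain ⟨hx, hy⟩ := hrun7 t h7 (by omega)
    clear hR0 hrun1 hrun2 hrun3 hrun4 hrun5 hrun6 hrun7 hR8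
    have hk1 : ¬ (t ≤ 2 * a + 1) := by omega
    have hk2 : ¬ (t ≤ 4 * a + 1) := by omega
    have hk3 : ¬ (t ≤ 4 * a + 2 * i + 3) := by omega
    have hk4 : ¬ (t ≤ 4 * a + 2 * i + 2 * j + 6) := by omega
    have hk5 : ¬ (t ≤ 4 * a + 2 * i + 2 * j + 2 * d + 9) := by omega
    have hk6 : ¬ (t ≤ 2 * k + 4 * a + 4) := by omega
    have hk7 : ¬ (t ≤ 2 * k + 4 * a + 2 * g + 6) := by omega
    have hk8 : t ≤ 4 * k + 2 * a + 4 := by omega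
    rw [hx, hy, if_neg hk1, if_neg hk1, if_neg hk2, if_neg hk2, if_neg hk3, if_neg hk3, if_neg hk4, if_neg hk4,
        if_neg hk5, if_neg hk5, if_neg hk6, if_neg hk6, if_neg hk7, if_neg hk7, if_pos hk8, if_pos hk8]
    constructor <;> omega
  obtain ⟨hx, hy⟩ := hR8 t h8 ht
  clear hR0 hrun1 hrun2 hrun3 hrun4 hrun5 hrun6 hrun7 hR8
  have hk1 : ¬ (t ≤ 2 * a + 1) := by omega
  have hk2 : ¬ (t ≤ 4 * a + 1) := by omega
  have hk3 : ¬ (t ≤ 4 * a + 2 * i + 3) := by omega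
  have hk4 : ¬ (t ≤ 4 * a + 2 * i + 2 * j + 6) := by omega
  have hk5 : ¬ (t ≤ 4 * a + 2 * i + 2 * j + 2 * d + 9) := by omega
  have hk6 : ¬ (t ≤ 2 * k + 4 * a + 4) := by omega
  have hk7 : ¬ (t ≤ 2 * k + 4 * a + 2 * g + 6) := by omega
  have hk8 : ¬ (t ≤ 4 * k + 2 * a + 4) := by omega
  rw [hx, hy, if_neg hk1, if_neg hk1, if_neg hk2, if_neg hk2, if_neg hk3, if_neg hk3, if_neg hk4, if_neg hk4,
      if_neg hk5, if_neg hk5, if_neg hk6, if_neg hk6, if_neg hk7, if_neg hk7, if_neg hk8, if_neg hk8]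
  constructor <;> omega

/-- **Family A12 identified**: a walk whose initial wall run is `0 … p`, whose seven body runs have the velocities
of family A12 (`L R R R R R R` on the rows `−1, −2, −3, −2, −3, −2, −1`) and whose vertical steps fall at the step
times of the table walk `s4f k i j d g` coincides with it up to time `6k + 4` (four-down analogue of
`ddduuu4_table_a` of `…SlackFourThreeDownLaw`). [cite: MadrasSlade1993, §4.2, Definition 4.2.1 (p. 90)]
[cite: EntingJensen2009, §7.4.2, Fig. 7.10] -/
theorem ddduduuu4_table_f {k p t₂ t₃ t₄ t₅ t₆ t₇ t₈ i j d g : ℕ}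
    (hF1 : i + j + d + g + 5 ≤ k) (hR0 : ∀ i, i ≤ p → ω i 0 = i ∧ ω i 1 = 0)
    (hrun1 : ∀ i, p + 1 ≤ i → i ≤ t₂ → ω i 0 = p + (-1) * ((i - (p + 1) : ℕ) : ℤ) ∧ ω i 1 = -1)
    (hrun2 : ∀ i, t₂ + 1 ≤ i → i ≤ t₃ → ω i 0 = ω t₂ 0 + 1 * ((i - (t₂ + 1) : ℕ) : ℤ) ∧ ω i 1 = -2)
    (hrun3 : ∀ i, t₃ + 1 ≤ i → i ≤ t₄ → ω i 0 = ω t₃ 0 + 1 * ((i - (t₃ + 1) : ℕ) : ℤ) ∧ ω i 1 = -3)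
    (hrun4 : ∀ i, t₄ + 1 ≤ i → i ≤ t₅ → ω i 0 = ω t₄ 0 + 1 * ((i - (t₄ + 1) : ℕ) : ℤ) ∧ ω i 1 = -2)
    (hrun5 : ∀ i, t₅ + 1 ≤ i → i ≤ t₆ → ω i 0 = ω t₅ 0 + 1 * ((i - (t₅ + 1) : ℕ) : ℤ) ∧ ω i 1 = -3)
    (hrun6 : ∀ i, t₆ + 1 ≤ i → i ≤ t₇ → ω i 0 = ω t₆ 0 + 1 * ((i - (t₆ + 1) : ℕ) : ℤ) ∧ ω i 1 = -2)
    (hrun7 : ∀ i, t₇ + 1 ≤ i → i ≤ t₈ → ω i 0 = ω t₇ 0 + 1 * ((i - (t₇ + 1) : ℕ) : ℤ) ∧ ω i 1 = -1)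
    (hR8 : ∀ j, t₈ + 1 ≤ j → j ≤ 6 * k + 4 → ω j 0 = ω t₈ 0 + ((j - (t₈ + 1) : ℕ) : ℤ) ∧ ω j 1 = 0)
    (hpe : p + 1 = 2 * k) (ht2e : t₂ + 3 = 4 * k) (ht3e : t₃ + 1 = 4 * k + 2 * i)
    (ht4e : t₄ = 4 * k + 2 * i + 2 * j + 2) (ht5e : t₅ = 4 * k + 2 * i + 2 * j + 2 * d + 5)
    (ht6e : t₆ + 2 * g + 2 = 6 * k) (ht7e : t₇ = 6 * k) (ht8e : t₈ = 6 * k + 2) :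
    ∀ t, t ≤ 6 * k + 4 → ω t 0 = s4fX k i j d g t ∧ ω t 1 = s4fY k i j d g t := by
  have hc1 := (hrun1 t₂ (by omega) le_rfl).1
  have hc2 := (hrun2 t₃ (by omega) le_rfl).1
  have hc3 := (hrun3 t₄ (by omega) le_rfl).1
  have hc4 := (hrun4 t₅ (by omega) le_rfl).1
  have hc5 := (hrun5 t₆ (by omega) le_rfl).1
  have hc6 := (hrun6 t₇ (by omega) le_rfl).1
  have hc7 := (hrun7 t₈ (by omega) le_rfl).1
  intro t ht
  simp only [s4fX, s4fY]
  rcases Nat.lt_or_ge t (p + 1) with h1 | h1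
  · obtain ⟨hx, hy⟩ := hR0 t (by omega)
    clear hR0 hrun1 hrun2 hrun3 hrun4 hrun5 hrun6 hrun7 hR8
    have hk1 : t + 1 ≤ 2 * k := by omega
    rw [hx, hy, if_pos hk1, if_pos hk1]
    constructor <;> omega
  rcases Nat.lt_or_ge t (t₂ + 1) with h2 | h2
  · obtain ⟨hx, hy⟩ := hrun1 t h1 (by omega)
    clear hR0 hrun1 hrun2 hrun3 hrun4 hrun5 hrun6 hrun7 hR8
    have hk1 : ¬ (t + 1 ≤ 2 * k) := by omega
    have hk2 : t + 3 ≤ 4 * k := by omega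
    rw [hx, hy, if_neg hk1, if_neg hk1, if_pos hk2, if_pos hk2]
    constructor <;> omega
  rcases Nat.lt_or_ge t (t₃ + 1) with h3 | h3
  · obtain ⟨hx, hy⟩ := hrun2 t h2 (by omega)
    clear hR0 hrun1 hrun2 hrun3 hrun4 hrun5 hrun6 hrun7 hR8
    have hk1 : ¬ (t + 1 ≤ 2 * k) := by omega
    have hk2 : ¬ (t + 3 ≤ 4 * k) := by omega
    have hk3 : t + 1 ≤ 4 * k + 2 * i := by omega
    rw [hx, hy, if_neg hk1, if_neg hk1, if_neg hk2, if_neg hk2, if_pos hk3, if_pos hk3]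
    constructor <;> omega
  rcases Nat.lt_or_ge t (t₄ + 1) with h4 | h4
  · obtain ⟨hx, hy⟩ := hrun3 t h3 (by omega)
    clear hR0 hrun1 hrun2 hrun3 hrun4 hrun5 hrun6 hrun7 hR8
    have hk1 : ¬ (t + 1 ≤ 2 * k) := by omega
    have hk2 : ¬ (t + 3 ≤ 4 * k) := by omega
    have hk3 : ¬ (t + 1 ≤ 4 * k + 2 * i) := by omega
    have hk4 : t ≤ 4 * k + 2 * i + 2 * j + 2 := by omega
    rw [hx, hy, if_neg hk1, if_neg hk1, if_neg hk2, if_neg hk2, if_neg hk3, if_neg hk3, if_pos hk4, if_pos hk4]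
    constructor <;> omega
  rcases Nat.lt_or_ge t (t₅ + 1) with h5 | h5
  · obtain ⟨hx, hy⟩ := hrun4 t h4 (by omega)
    clear hR0 hrun1 hrun2 hrun3 hrun4 hrun5 hrun6 hrun7 hR8
    have hk1 : ¬ (t + 1 ≤ 2 * k) := by omega
    have hk2 : ¬ (t + 3 ≤ 4 * k) := by omega
    have hk3 : ¬ (t + 1 ≤ 4 * k + 2 * i) := by omega
    have hk4 : ¬ (t ≤ 4 * k + 2 * i + 2 * j + 2) := by omega
    have hk5 : t ≤ 4 * k + 2 * i + 2 * j + 2 * d + 5 := by omega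
    rw [hx, hy, if_neg hk1, if_neg hk1, if_neg hk2, if_neg hk2, if_neg hk3, if_neg hk3, if_neg hk4, if_neg hk4,
        if_pos hk5, if_pos hk5]
    constructor <;> omega
  rcases Nat.lt_or_ge t (t₆ + 1) with h6 | h6
  · obtain ⟨hx, hy⟩ := hrun5 t h5 (by omega)
    clear hR0 hrun1 hrun2 hrun3 hrun4 hrun5 hrun6 hrun7 hR8
    have hk1 : ¬ (t + 1 ≤ 2 * k) := by omega
    have hk2 : ¬ (t + 3 ≤ 4 * k) := by omega
    have hk3 : ¬ (t + 1 ≤ 4 * k + 2 * i) := by omega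
    have hk4 : ¬ (t ≤ 4 * k + 2 * i + 2 * j + 2) := by omega
    have hk5 : ¬ (t ≤ 4 * k + 2 * i + 2 * j + 2 * d + 5) := by omega
    have hk6 : t + 2 * g + 2 ≤ 6 * k := by omega
    rw [hx, hy, if_neg hk1, if_neg hk1, if_neg hk2, if_neg hk2, if_neg hk3, if_neg hk3, if_neg hk4, if_neg hk4,
        if_neg hk5, if_neg hk5, if_pos hk6, if_pos hk6]
    constructor <;> omega
  rcases Nat.lt_or_ge t (t₇ + 1) with h7 | h7
  · obtain ⟨hx, hy⟩ := hrun6 t h6 (by omega)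
    clear hR0 hrun1 hrun2 hrun3 hrun4 hrun5 hrun6 hrun7 hR8
    have hk1 : ¬ (t + 1 ≤ 2 * k) := by omega
    have hk2 : ¬ (t + 3 ≤ 4 * k) := by omega
    have hk3 : ¬ (t + 1 ≤ 4 * k + 2 * i) := by omega
    have hk4 : ¬ (t ≤ 4 * k + 2 * i + 2 * j + 2) := by omega
    have hk5 : ¬ (t ≤ 4 * k + 2 * i + 2 * j + 2 * d + 5) := by omega
    have hk6 : ¬ (t + 2 * g + 2 ≤ 6 * k) := by omega
    have hk7 : t ≤ 6 * k := by omega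
    rw [hx, hy, if_neg hk1, if_neg hk1, if_neg hk2, if_neg hk2, if_neg hk3, if_neg hk3, if_neg hk4, if_neg hk4,
        if_neg hk5, if_neg hk5, if_neg hk6, if_neg hk6, if_pos hk7, if_pos hk7]
    constructor <;> omega
  rcases Nat.lt_or_ge t (t₈ + 1) with h8 | h8
  · obtain ⟨hx, hy⟩ := hrun7 t h7 (by omega)
    clear hR0 hrun1 hrun2 hrun3 hrun4 hrun5 hrun6 hrun7 hR8
    have hk1 : ¬ (t + 1 ≤ 2 * k) := by omega
    have hk2 : ¬ (t + 3 ≤ 4 * k) := by omega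
    have hk3 : ¬ (t + 1 ≤ 4 * k + 2 * i) := by omega
    have hk4 : ¬ (t ≤ 4 * k + 2 * i + 2 * j + 2) := by omega
    have hk5 : ¬ (t ≤ 4 * k + 2 * i + 2 * j + 2 * d + 5) := by omega
    have hk6 : ¬ (t + 2 * g + 2 ≤ 6 * k) := by omega
    have hk7 : ¬ (t ≤ 6 * k) := by omega
    have hk8 : t ≤ 6 * k + 2 := by omega
    rw [hx, hy, if_neg hk1, if_neg hk1, if_neg hk2, if_neg hk2, if_neg hk3, if_neg hk3, if_neg hk4, if_neg hk4,
        if_neg hk5, if_neg hk5, if_neg hk6, if_neg hk6, if_neg hk7, if_neg hk7, if_pos hk8, if_pos hk8]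
    constructor <;> omega
  obtain ⟨hx, hy⟩ := hR8 t h8 ht
  clear hR0 hrun1 hrun2 hrun3 hrun4 hrun5 hrun6 hrun7 hR8
  have hk1 : ¬ (t + 1 ≤ 2 * k) := by omega
  have hk2 : ¬ (t + 3 ≤ 4 * k) := by omega
  have hk3 : ¬ (t + 1 ≤ 4 * k + 2 * i) := by omega
  have hk4 : ¬ (t ≤ 4 * k + 2 * i + 2 * j + 2) := by omega
  have hk5 : ¬ (t ≤ 4 * k + 2 * i + 2 * j + 2 * d + 5) := by omega
  have hk6 : ¬ (t + 2 * g + 2 ≤ 6 * k) := by omega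
  have hk7 : ¬ (t ≤ 6 * k) := by omega
  have hk8 : ¬ (t ≤ 6 * k + 2) := by omega
  rw [hx, hy, if_neg hk1, if_neg hk1, if_neg hk2, if_neg hk2, if_neg hk3, if_neg hk3, if_neg hk4, if_neg hk4,
      if_neg hk5, if_neg hk5, if_neg hk6, if_neg hk6, if_neg hk7, if_neg hk7, if_neg hk8, if_neg hk8]
  constructor <;> omega

/-- **Family A13 identified**: a walk whose initial wall run is `0 … p`, whose seven body runs have the velocities
of family A13 (`L R R L L L L` on the rows `−1, −2, −3, −2, −1, −2, −1`) and whose vertical steps fall at the step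
times of the table walk `s4g k a i d e g` coincides with it up to time `6k + 4` (four-down analogue of
`ddduuu4_table_a` of `…SlackFourThreeDownLaw`). [cite: MadrasSlade1993, §4.2, Definition 4.2.1 (p. 90)]
[cite: EntingJensen2009, §7.4.2, Fig. 7.10] -/
theorem ddduuduu4_table_g {k p t₂ t₃ t₄ t₅ t₆ t₇ t₈ a i d e g : ℕ}
    (hF1 : 1 ≤ a) (hF2 : a + d + e + g + 4 ≤ k) (hF3 : i + d + e + g + 4 ≤ k)
    (hR0 : ∀ i, i ≤ p → ω i 0 = i ∧ ω i 1 = 0)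
    (hrun1 : ∀ i, p + 1 ≤ i → i ≤ t₂ → ω i 0 = p + (-1) * ((i - (p + 1) : ℕ) : ℤ) ∧ ω i 1 = -1)
    (hrun2 : ∀ i, t₂ + 1 ≤ i → i ≤ t₃ → ω i 0 = ω t₂ 0 + 1 * ((i - (t₂ + 1) : ℕ) : ℤ) ∧ ω i 1 = -2)
    (hrun3 : ∀ i, t₃ + 1 ≤ i → i ≤ t₄ → ω i 0 = ω t₃ 0 + 1 * ((i - (t₃ + 1) : ℕ) : ℤ) ∧ ω i 1 = -3)
    (hrun4 : ∀ i, t₄ + 1 ≤ i → i ≤ t₅ → ω i 0 = ω t₄ 0 + (-1) * ((i - (t₄ + 1) : ℕ) : ℤ) ∧ ω i 1 = -2)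
    (hrun5 : ∀ i, t₅ + 1 ≤ i → i ≤ t₆ → ω i 0 = ω t₅ 0 + (-1) * ((i - (t₅ + 1) : ℕ) : ℤ) ∧ ω i 1 = -1)
    (hrun6 : ∀ i, t₆ + 1 ≤ i → i ≤ t₇ → ω i 0 = ω t₆ 0 + (-1) * ((i - (t₆ + 1) : ℕ) : ℤ) ∧ ω i 1 = -2)
    (hrun7 : ∀ i, t₇ + 1 ≤ i → i ≤ t₈ → ω i 0 = ω t₇ 0 + (-1) * ((i - (t₇ + 1) : ℕ) : ℤ) ∧ ω i 1 = -1)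
    (hR8 : ∀ j, t₈ + 1 ≤ j → j ≤ 6 * k + 4 → ω j 0 = ω t₈ 0 + ((j - (t₈ + 1) : ℕ) : ℤ) ∧ ω j 1 = 0)
    (hpe : p = 2 * a + 1) (ht2e : t₂ = 4 * a + 1) (ht3e : t₃ = 4 * a + 2 * i + 3) (ht4e : t₄ = 2 * k + 4 * a + 2)
    (ht5e : t₅ = 2 * k + 4 * a + 2 * d + 4) (ht6e : t₆ = 2 * k + 4 * a + 2 * d + 2 * e + 7)
    (ht7e : t₇ = 2 * k + 4 * a + 2 * d + 2 * e + 2 * g + 10) (ht8e : t₈ = 4 * k + 2 * a + 4) :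
    ∀ t, t ≤ 6 * k + 4 → ω t 0 = s4gX k a i d e g t ∧ ω t 1 = s4gY k a i d e g t := by
  have hc1 := (hrun1 t₂ (by omega) le_rfl).1
  have hc2 := (hrun2 t₃ (by omega) le_rfl).1
  have hc3 := (hrun3 t₄ (by omega) le_rfl).1
  have hc4 := (hrun4 t₅ (by omega) le_rfl).1
  have hc5 := (hrun5 t₆ (by omega) le_rfl).1
  have hc6 := (hrun6 t₇ (by omega) le_rfl).1
  have hc7 := (hrun7 t₈ (by omega) le_rfl).1
  intro t ht
  simp only [s4gX, s4gY]
  rcases Nat.lt_or_ge t (p + 1) with h1 | h1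
  · obtain ⟨hx, hy⟩ := hR0 t (by omega)
    clear hR0 hrun1 hrun2 hrun3 hrun4 hrun5 hrun6 hrun7 hR8
    have hk1 : t ≤ 2 * a + 1 := by omega
    rw [hx, hy, if_pos hk1, if_pos hk1]
    constructor <;> omega
  rcases Nat.lt_or_ge t (t₂ + 1) with h2 | h2
  · obtain ⟨hx, hy⟩ := hrun1 t h1 (by omega)
    clear hR0 hrun1 hrun2 hrun3 hrun4 hrun5 hrun6 hrun7 hR8
    have hk1 : ¬ (t ≤ 2 * a + 1) := by omega
    have hk2 : t ≤ 4 * a + 1 := by omega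
    rw [hx, hy, if_neg hk1, if_neg hk1, if_pos hk2, if_pos hk2]
    constructor <;> omega
  rcases Nat.lt_or_ge t (t₃ + 1) with h3 | h3
  · obtain ⟨hx, hy⟩ := hrun2 t h2 (by omega)
    clear hR0 hrun1 hrun2 hrun3 hrun4 hrun5 hrun6 hrun7 hR8
    have hk1 : ¬ (t ≤ 2 * a + 1) := by omega
    have hk2 : ¬ (t ≤ 4 * a + 1) := by omega
    have hk3 : t ≤ 4 * a + 2 * i + 3 := by omega
    rw [hx, hy, if_neg hk1, if_neg hk1, if_neg hk2, if_neg hk2, if_pos hk3, if_pos hk3]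
    constructor <;> omega
  rcases Nat.lt_or_ge t (t₄ + 1) with h4 | h4
  · obtain ⟨hx, hy⟩ := hrun3 t h3 (by omega)
    clear hR0 hrun1 hrun2 hrun3 hrun4 hrun5 hrun6 hrun7 hR8
    have hk1 : ¬ (t ≤ 2 * a + 1) := by omega
    have hk2 : ¬ (t ≤ 4 * a + 1) := by omega
    have hk3 : ¬ (t ≤ 4 * a + 2 * i + 3) := by omega
    have hk4 : t ≤ 2 * k + 4 * a + 2 := by omega
    rw [hx, hy, if_neg hk1, if_neg hk1, if_neg hk2, if_neg hk2, if_neg hk3, if_neg hk3, if_pos hk4, if_pos hk4]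
    constructor <;> omega
  rcases Nat.lt_or_ge t (t₅ + 1) with h5 | h5
  · obtain ⟨hx, hy⟩ := hrun4 t h4 (by omega)
    clear hR0 hrun1 hrun2 hrun3 hrun4 hrun5 hrun6 hrun7 hR8
    have hk1 : ¬ (t ≤ 2 * a + 1) := by omega
    have hk2 : ¬ (t ≤ 4 * a + 1) := by omega
    have hk3 : ¬ (t ≤ 4 * a + 2 * i + 3) := by omega
    have hk4 : ¬ (t ≤ 2 * k + 4 * a + 2) := by omega
    have hk5 : t ≤ 2 * k + 4 * a + 2 * d + 4 := by omega
    rw [hx, hy, if_neg hk1, if_neg hk1, if_neg hk2, if_neg hk2, if_neg hk3, if_neg hk3, if_neg hk4, if_neg hk4,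
        if_pos hk5, if_pos hk5]
    constructor <;> omega
  rcases Nat.lt_or_ge t (t₆ + 1) with h6 | h6
  · obtain ⟨hx, hy⟩ := hrun5 t h5 (by omega)
    clear hR0 hrun1 hrun2 hrun3 hrun4 hrun5 hrun6 hrun7 hR8
    have hk1 : ¬ (t ≤ 2 * a + 1) := by omega
    have hk2 : ¬ (t ≤ 4 * a + 1) := by omega
    have hk3 : ¬ (t ≤ 4 * a + 2 * i + 3) := by omega
    have hk4 : ¬ (t ≤ 2 * k + 4 * a + 2) := by omega
    have hk5 : ¬ (t ≤ 2 * k + 4 * a + 2 * d + 4) := by omega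
    have hk6 : t ≤ 2 * k + 4 * a + 2 * d + 2 * e + 7 := by omega
    rw [hx, hy, if_neg hk1, if_neg hk1, if_neg hk2, if_neg hk2, if_neg hk3, if_neg hk3, if_neg hk4, if_neg hk4,
        if_neg hk5, if_neg hk5, if_pos hk6, if_pos hk6]
    constructor <;> omega
  rcases Nat.lt_or_ge t (t₇ + 1) with h7 | h7
  · obtain ⟨hx, hy⟩ := hrun6 t h6 (by omega)
    clear hR0 hrun1 hrun2 hrun3 hrun4 hrun5 hrun6 hrun7 hR8
    have hk1 : ¬ (t ≤ 2 * a + 1) := by omega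
    have hk2 : ¬ (t ≤ 4 * a + 1) := by omega
    have hk3 : ¬ (t ≤ 4 * a + 2 * i + 3) := by omega
    have hk4 : ¬ (t ≤ 2 * k + 4 * a + 2) := by omega
    have hk5 : ¬ (t ≤ 2 * k + 4 * a + 2 * d + 4) := by omega
    have hk6 : ¬ (t ≤ 2 * k + 4 * a + 2 * d + 2 * e + 7) := by omega
    have hk7 : t ≤ 2 * k + 4 * a + 2 * d + 2 * e + 2 * g + 10 := by omega
    rw [hx, hy, if_neg hk1, if_neg hk1, if_neg hk2, if_neg hk2, if_neg hk3, if_neg hk3, if_neg hk4, if_neg hk4,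
        if_neg hk5, if_neg hk5, if_neg hk6, if_neg hk6, if_pos hk7, if_pos hk7]
    constructor <;> omega
  rcases Nat.lt_or_ge t (t₈ + 1) with h8 | h8
  · obtain ⟨hx, hy⟩ := hrun7 t h7 (by omega)
    clear hR0 hrun1 hrun2 hrun3 hrun4 hrun5 hrun6 hrun7 hR8
    have hk1 : ¬ (t ≤ 2 * a + 1) := by omega
    have hk2 : ¬ (t ≤ 4 * a + 1) := by omega
    have hk3 : ¬ (t ≤ 4 * a + 2 * i + 3) := by omega
    have hk4 : ¬ (t ≤ 2 * k + 4 * a + 2) := by omega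
    have hk5 : ¬ (t ≤ 2 * k + 4 * a + 2 * d + 4) := by omega
    have hk6 : ¬ (t ≤ 2 * k + 4 * a + 2 * d + 2 * e + 7) := by omega
    have hk7 : ¬ (t ≤ 2 * k + 4 * a + 2 * d + 2 * e + 2 * g + 10) := by omega
    have hk8 : t ≤ 4 * k + 2 * a + 4 := by omega
    rw [hx, hy, if_neg hk1, if_neg hk1, if_neg hk2, if_neg hk2, if_neg hk3, if_neg hk3, if_neg hk4, if_neg hk4,
        if_neg hk5, if_neg hk5, if_neg hk6, if_neg hk6, if_neg hk7, if_neg hk7, if_pos hk8, if_pos hk8]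
    constructor <;> omega
  obtain ⟨hx, hy⟩ := hR8 t h8 ht
  clear hR0 hrun1 hrun2 hrun3 hrun4 hrun5 hrun6 hrun7 hR8
  have hk1 : ¬ (t ≤ 2 * a + 1) := by omega
  have hk2 : ¬ (t ≤ 4 * a + 1) := by omega
  have hk3 : ¬ (t ≤ 4 * a + 2 * i + 3) := by omega
  have hk4 : ¬ (t ≤ 2 * k + 4 * a + 2) := by omega
  have hk5 : ¬ (t ≤ 2 * k + 4 * a + 2 * d + 4) := by omega
  have hk6 : ¬ (t ≤ 2 * k + 4 * a + 2 * d + 2 * e + 7) := by omega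
  have hk7 : ¬ (t ≤ 2 * k + 4 * a + 2 * d + 2 * e + 2 * g + 10) := by omega
  have hk8 : ¬ (t ≤ 4 * k + 2 * a + 4) := by omega
  rw [hx, hy, if_neg hk1, if_neg hk1, if_neg hk2, if_neg hk2, if_neg hk3, if_neg hk3, if_neg hk4, if_neg hk4,
      if_neg hk5, if_neg hk5, if_neg hk6, if_neg hk6, if_neg hk7, if_neg hk7, if_neg hk8, if_neg hk8]
  constructor <;> omega

/-- **Family A14 identified**: a walk whose initial wall run is `0 … p`, whose seven body runs have the velocities
of family A14 (`L L L R R L L` on the rows `−1, −2, −1, −2, −3, −2, −1`) and whose vertical steps fall at the step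
times of the table walk `s4h k a i j d g` coincides with it up to time `6k + 4` (four-down analogue of
`ddduuu4_table_a` of `…SlackFourThreeDownLaw`). [cite: MadrasSlade1993, §4.2, Definition 4.2.1 (p. 90)]
[cite: EntingJensen2009, §7.4.2, Fig. 7.10] -/
theorem ddudduuu4_table_h {k p t₂ t₃ t₄ t₅ t₆ t₇ t₈ a i j d g : ℕ}
    (hF1 : i + j + d + 3 ≤ a) (hF2 : a + g + 2 ≤ k) (hR0 : ∀ i, i ≤ p → ω i 0 = i ∧ ω i 1 = 0)
    (hrun1 : ∀ i, p + 1 ≤ i → i ≤ t₂ → ω i 0 = p + (-1) * ((i - (p + 1) : ℕ) : ℤ) ∧ ω i 1 = -1)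
    (hrun2 : ∀ i, t₂ + 1 ≤ i → i ≤ t₃ → ω i 0 = ω t₂ 0 + (-1) * ((i - (t₂ + 1) : ℕ) : ℤ) ∧ ω i 1 = -2)
    (hrun3 : ∀ i, t₃ + 1 ≤ i → i ≤ t₄ → ω i 0 = ω t₃ 0 + (-1) * ((i - (t₃ + 1) : ℕ) : ℤ) ∧ ω i 1 = -1)
    (hrun4 : ∀ i, t₄ + 1 ≤ i → i ≤ t₅ → ω i 0 = ω t₄ 0 + 1 * ((i - (t₄ + 1) : ℕ) : ℤ) ∧ ω i 1 = -2)
    (hrun5 : ∀ i, t₅ + 1 ≤ i → i ≤ t₆ → ω i 0 = ω t₅ 0 + 1 * ((i - (t₅ + 1) : ℕ) : ℤ) ∧ ω i 1 = -3)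
    (hrun6 : ∀ i, t₆ + 1 ≤ i → i ≤ t₇ → ω i 0 = ω t₆ 0 + (-1) * ((i - (t₆ + 1) : ℕ) : ℤ) ∧ ω i 1 = -2)
    (hrun7 : ∀ i, t₇ + 1 ≤ i → i ≤ t₈ → ω i 0 = ω t₇ 0 + (-1) * ((i - (t₇ + 1) : ℕ) : ℤ) ∧ ω i 1 = -1)
    (hR8 : ∀ j, t₈ + 1 ≤ j → j ≤ 6 * k + 4 → ω j 0 = ω t₈ 0 + ((j - (t₈ + 1) : ℕ) : ℤ) ∧ ω j 1 = 0)
    (hpe : p = 2 * a + 1) (ht2e : t₂ = 2 * a + 2 * i + 3) (ht3e : t₃ = 2 * a + 2 * i + 2 * j + 6)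
    (ht4e : t₄ = 4 * a + 3) (ht5e : t₅ = 4 * a + 2 * d + 5) (ht6e : t₆ = 2 * k + 4 * a + 4)
    (ht7e : t₇ = 2 * k + 4 * a + 2 * g + 6) (ht8e : t₈ = 4 * k + 2 * a + 4) :
    ∀ t, t ≤ 6 * k + 4 → ω t 0 = s4hX k a i j d g t ∧ ω t 1 = s4hY k a i j d g t := by
  have hc1 := (hrun1 t₂ (by omega) le_rfl).1
  have hc2 := (hrun2 t₃ (by omega) le_rfl).1
  have hc3 := (hrun3 t₄ (by omega) le_rfl).1
  have hc4 := (hrun4 t₅ (by omega) le_rfl).1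
  have hc5 := (hrun5 t₆ (by omega) le_rfl).1
  have hc6 := (hrun6 t₇ (by omega) le_rfl).1
  have hc7 := (hrun7 t₈ (by omega) le_rfl).1
  intro t ht
  simp only [s4hX, s4hY]
  rcases Nat.lt_or_ge t (p + 1) with h1 | h1
  · obtain ⟨hx, hy⟩ := hR0 t (by omega)
    clear hR0 hrun1 hrun2 hrun3 hrun4 hrun5 hrun6 hrun7 hR8
    have hk1 : t ≤ 2 * a + 1 := by omega
    rw [hx, hy, if_pos hk1, if_pos hk1]
    constructor <;> omega
  rcases Nat.lt_or_ge t (t₂ + 1) with h2 | h2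
  · obtain ⟨hx, hy⟩ := hrun1 t h1 (by omega)
    clear hR0 hrun1 hrun2 hrun3 hrun4 hrun5 hrun6 hrun7 hR8
    have hk1 : ¬ (t ≤ 2 * a + 1) := by omega
    have hk2 : t ≤ 2 * a + 2 * i + 3 := by omega
    rw [hx, hy, if_neg hk1, if_neg hk1, if_pos hk2, if_pos hk2]
    constructor <;> omega
  rcases Nat.lt_or_ge t (t₃ + 1) with h3 | h3
  · obtain ⟨hx, hy⟩ := hrun2 t h2 (by omega)
    clear hR0 hrun1 hrun2 hrun3 hrun4 hrun5 hrun6 hrun7 hR8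
    have hk1 : ¬ (t ≤ 2 * a + 1) := by omega
    have hk2 : ¬ (t ≤ 2 * a + 2 * i + 3) := by omega
    have hk3 : t ≤ 2 * a + 2 * i + 2 * j + 6 := by omega
    rw [hx, hy, if_neg hk1, if_neg hk1, if_neg hk2, if_neg hk2, if_pos hk3, if_pos hk3]
    constructor <;> omega
  rcases Nat.lt_or_ge t (t₄ + 1) with h4 | h4
  · obtain ⟨hx, hy⟩ := hrun3 t h3 (by omega)
    clear hR0 hrun1 hrun2 hrun3 hrun4 hrun5 hrun6 hrun7 hR8
    have hk1 : ¬ (t ≤ 2 * a + 1) := by omega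
    have hk2 : ¬ (t ≤ 2 * a + 2 * i + 3) := by omega
    have hk3 : ¬ (t ≤ 2 * a + 2 * i + 2 * j + 6) := by omega
    have hk4 : t ≤ 4 * a + 3 := by omega
    rw [hx, hy, if_neg hk1, if_neg hk1, if_neg hk2, if_neg hk2, if_neg hk3, if_neg hk3, if_pos hk4, if_pos hk4]
    constructor <;> omega
  rcases Nat.lt_or_ge t (t₅ + 1) with h5 | h5
  · obtain ⟨hx, hy⟩ := hrun4 t h4 (by omega)
    clear hR0 hrun1 hrun2 hrun3 hrun4 hrun5 hrun6 hrun7 hR8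
    have hk1 : ¬ (t ≤ 2 * a + 1) := by omega
    have hk2 : ¬ (t ≤ 2 * a + 2 * i + 3) := by omega
    have hk3 : ¬ (t ≤ 2 * a + 2 * i + 2 * j + 6) := by omega
    have hk4 : ¬ (t ≤ 4 * a + 3) := by omega
    have hk5 : t ≤ 4 * a + 2 * d + 5 := by omega
    rw [hx, hy, if_neg hk1, if_neg hk1, if_neg hk2, if_neg hk2, if_neg hk3, if_neg hk3, if_neg hk4, if_neg hk4,
        if_pos hk5, if_pos hk5]
    constructor <;> omega
  rcases Nat.lt_or_ge t (t₆ + 1) with h6 | h6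
  · obtain ⟨hx, hy⟩ := hrun5 t h5 (by omega)
    clear hR0 hrun1 hrun2 hrun3 hrun4 hrun5 hrun6 hrun7 hR8
    have hk1 : ¬ (t ≤ 2 * a + 1) := by omega
    have hk2 : ¬ (t ≤ 2 * a + 2 * i + 3) := by omega
    have hk3 : ¬ (t ≤ 2 * a + 2 * i + 2 * j + 6) := by omega
    have hk4 : ¬ (t ≤ 4 * a + 3) := by omega
    have hk5 : ¬ (t ≤ 4 * a + 2 * d + 5) := by omega
    have hk6 : t ≤ 2 * k + 4 * a + 4 := by omega
    rw [hx, hy, if_neg hk1, if_neg hk1, if_neg hk2, if_neg hk2, if_neg hk3, if_neg hk3, if_neg hk4, if_neg hk4,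
        if_neg hk5, if_neg hk5, if_pos hk6, if_pos hk6]
    constructor <;> omega
  rcases Nat.lt_or_ge t (t₇ + 1) with h7 | h7
  · obtain ⟨hx, hy⟩ := hrun6 t h6 (by omega)
    clear hR0 hrun1 hrun2 hrun3 hrun4 hrun5 hrun6 hrun7 hR8
    have hk1 : ¬ (t ≤ 2 * a + 1) := by omega
    have hk2 : ¬ (t ≤ 2 * a + 2 * i + 3) := by omega
    have hk3 : ¬ (t ≤ 2 * a + 2 * i + 2 * j + 6) := by omega
    have hk4 : ¬ (t ≤ 4 * a + 3) := by omega
    have hk5 : ¬ (t ≤ 4 * a + 2 * d + 5) := by omega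
    have hk6 : ¬ (t ≤ 2 * k + 4 * a + 4) := by omega
    have hk7 : t ≤ 2 * k + 4 * a + 2 * g + 6 := by omega
    rw [hx, hy, if_neg hk1, if_neg hk1, if_neg hk2, if_neg hk2, if_neg hk3, if_neg hk3, if_neg hk4, if_neg hk4,
        if_neg hk5, if_neg hk5, if_neg hk6, if_neg hk6, if_pos hk7, if_pos hk7]
    constructor <;> omega
  rcases Nat.lt_or_ge t (t₈ + 1) with h8 | h8
  · obtain ⟨hx, hy⟩ := hrun7 t h7 (by omega)
    clear hR0 hrun1 hrun2 hrun3 hrun4 hrun5 hrun6 hrun7 hR8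
    have hk1 : ¬ (t ≤ 2 * a + 1) := by omega
    have hk2 : ¬ (t ≤ 2 * a + 2 * i + 3) := by omega
    have hk3 : ¬ (t ≤ 2 * a + 2 * i + 2 * j + 6) := by omega
    have hk4 : ¬ (t ≤ 4 * a + 3) := by omega
    have hk5 : ¬ (t ≤ 4 * a + 2 * d + 5) := by omega
    have hk6 : ¬ (t ≤ 2 * k + 4 * a + 4) := by omega
    have hk7 : ¬ (t ≤ 2 * k + 4 * a + 2 * g + 6) := by omega
    have hk8 : t ≤ 4 * k + 2 * a + 4 := by omega
    rw [hx, hy, if_neg hk1, if_neg hk1, if_neg hk2, if_neg hk2, if_neg hk3, if_neg hk3, if_neg hk4, if_neg hk4,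
        if_neg hk5, if_neg hk5, if_neg hk6, if_neg hk6, if_neg hk7, if_neg hk7, if_pos hk8, if_pos hk8]
    constructor <;> omega
  obtain ⟨hx, hy⟩ := hR8 t h8 ht
  clear hR0 hrun1 hrun2 hrun3 hrun4 hrun5 hrun6 hrun7 hR8
  have hk1 : ¬ (t ≤ 2 * a + 1) := by omega
  have hk2 : ¬ (t ≤ 2 * a + 2 * i + 3) := by omega
  have hk3 : ¬ (t ≤ 2 * a + 2 * i + 2 * j + 6) := by omega
  have hk4 : ¬ (t ≤ 4 * a + 3) := by omega
  have hk5 : ¬ (t ≤ 4 * a + 2 * d + 5) := by omega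
  have hk6 : ¬ (t ≤ 2 * k + 4 * a + 4) := by omega
  have hk7 : ¬ (t ≤ 2 * k + 4 * a + 2 * g + 6) := by omega
  have hk8 : ¬ (t ≤ 4 * k + 2 * a + 4) := by omega
  rw [hx, hy, if_neg hk1, if_neg hk1, if_neg hk2, if_neg hk2, if_neg hk3, if_neg hk3, if_neg hk4, if_neg hk4,
      if_neg hk5, if_neg hk5, if_neg hk6, if_neg hk6, if_neg hk7, if_neg hk7, if_neg hk8, if_neg hk8]
  constructor <;> omega

/-- **Family A15 identified**: a walk whose initial wall run is `0 … p`, whose seven body runs have the velocities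
of family A15 (`L L L R R R R` on the rows `−1, −2, −1, −2, −3, −2, −1`) and whose vertical steps fall at the step
times of the table walk `s4i k i j d g` coincides with it up to time `6k + 4` (four-down analogue of
`ddduuu4_table_a` of `…SlackFourThreeDownLaw`). [cite: MadrasSlade1993, §4.2, Definition 4.2.1 (p. 90)]
[cite: EntingJensen2009, §7.4.2, Fig. 7.10] -/
theorem ddudduuu4_table_i {k p t₂ t₃ t₄ t₅ t₆ t₇ t₈ i j d g : ℕ}
    (hF1 : i + j + d + 4 ≤ k) (hF2 : g ≤ i) (hR0 : ∀ i, i ≤ p → ω i 0 = i ∧ ω i 1 = 0)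
    (hrun1 : ∀ i, p + 1 ≤ i → i ≤ t₂ → ω i 0 = p + (-1) * ((i - (p + 1) : ℕ) : ℤ) ∧ ω i 1 = -1)
    (hrun2 : ∀ i, t₂ + 1 ≤ i → i ≤ t₃ → ω i 0 = ω t₂ 0 + (-1) * ((i - (t₂ + 1) : ℕ) : ℤ) ∧ ω i 1 = -2)
    (hrun3 : ∀ i, t₃ + 1 ≤ i → i ≤ t₄ → ω i 0 = ω t₃ 0 + (-1) * ((i - (t₃ + 1) : ℕ) : ℤ) ∧ ω i 1 = -1)
    (hrun4 : ∀ i, t₄ + 1 ≤ i → i ≤ t₅ → ω i 0 = ω t₄ 0 + 1 * ((i - (t₄ + 1) : ℕ) : ℤ) ∧ ω i 1 = -2)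
    (hrun5 : ∀ i, t₅ + 1 ≤ i → i ≤ t₆ → ω i 0 = ω t₅ 0 + 1 * ((i - (t₅ + 1) : ℕ) : ℤ) ∧ ω i 1 = -3)
    (hrun6 : ∀ i, t₆ + 1 ≤ i → i ≤ t₇ → ω i 0 = ω t₆ 0 + 1 * ((i - (t₆ + 1) : ℕ) : ℤ) ∧ ω i 1 = -2)
    (hrun7 : ∀ i, t₇ + 1 ≤ i → i ≤ t₈ → ω i 0 = ω t₇ 0 + 1 * ((i - (t₇ + 1) : ℕ) : ℤ) ∧ ω i 1 = -1)
    (hR8 : ∀ j, t₈ + 1 ≤ j → j ≤ 6 * k + 4 → ω j 0 = ω t₈ 0 + ((j - (t₈ + 1) : ℕ) : ℤ) ∧ ω j 1 = 0)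
    (hpe : p + 1 = 2 * k) (ht2e : t₂ = 2 * k + 2 * i + 1) (ht3e : t₃ = 2 * k + 2 * i + 2 * j + 4)
    (ht4e : t₄ + 1 = 4 * k) (ht5e : t₅ = 4 * k + 2 * d + 1) (ht6e : t₆ + 2 * g + 2 = 6 * k) (ht7e : t₇ = 6 * k)
    (ht8e : t₈ = 6 * k + 2) :
    ∀ t, t ≤ 6 * k + 4 → ω t 0 = s4iX k i j d g t ∧ ω t 1 = s4iY k i j d g t := by
  have hc1 := (hrun1 t₂ (by omega) le_rfl).1
  have hc2 := (hrun2 t₃ (by omega) le_rfl).1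
  have hc3 := (hrun3 t₄ (by omega) le_rfl).1
  have hc4 := (hrun4 t₅ (by omega) le_rfl).1
  have hc5 := (hrun5 t₆ (by omega) le_rfl).1
  have hc6 := (hrun6 t₇ (by omega) le_rfl).1
  have hc7 := (hrun7 t₈ (by omega) le_rfl).1
  intro t ht
  simp only [s4iX, s4iY]
  rcases Nat.lt_or_ge t (p + 1) with h1 | h1
  · obtain ⟨hx, hy⟩ := hR0 t (by omega)
    clear hR0 hrun1 hrun2 hrun3 hrun4 hrun5 hrun6 hrun7 hR8
    have hk1 : t + 1 ≤ 2 * k := by omega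
    rw [hx, hy, if_pos hk1, if_pos hk1]
    constructor <;> omega
  rcases Nat.lt_or_ge t (t₂ + 1) with h2 | h2
  · obtain ⟨hx, hy⟩ := hrun1 t h1 (by omega)
    clear hR0 hrun1 hrun2 hrun3 hrun4 hrun5 hrun6 hrun7 hR8
    have hk1 : ¬ (t + 1 ≤ 2 * k) := by omega
    have hk2 : t ≤ 2 * k + 2 * i + 1 := by omega
    rw [hx, hy, if_neg hk1, if_neg hk1, if_pos hk2, if_pos hk2]
    constructor <;> omega
  rcases Nat.lt_or_ge t (t₃ + 1) with h3 | h3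
  · obtain ⟨hx, hy⟩ := hrun2 t h2 (by omega)
    clear hR0 hrun1 hrun2 hrun3 hrun4 hrun5 hrun6 hrun7 hR8
    have hk1 : ¬ (t + 1 ≤ 2 * k) := by omega
    have hk2 : ¬ (t ≤ 2 * k + 2 * i + 1) := by omega
    have hk3 : t ≤ 2 * k + 2 * i + 2 * j + 4 := by omega
    rw [hx, hy, if_neg hk1, if_neg hk1, if_neg hk2, if_neg hk2, if_pos hk3, if_pos hk3]
    constructor <;> omega
  rcases Nat.lt_or_ge t (t₄ + 1) with h4 | h4
  · obtain ⟨hx, hy⟩ := hrun3 t h3 (by omega)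
    clear hR0 hrun1 hrun2 hrun3 hrun4 hrun5 hrun6 hrun7 hR8
    have hk1 : ¬ (t + 1 ≤ 2 * k) := by omega
    have hk2 : ¬ (t ≤ 2 * k + 2 * i + 1) := by omega
    have hk3 : ¬ (t ≤ 2 * k + 2 * i + 2 * j + 4) := by omega
    have hk4 : t + 1 ≤ 4 * k := by omega
    rw [hx, hy, if_neg hk1, if_neg hk1, if_neg hk2, if_neg hk2, if_neg hk3, if_neg hk3, if_pos hk4, if_pos hk4]
    constructor <;> omega
  rcases Nat.lt_or_ge t (t₅ + 1) with h5 | h5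
  · obtain ⟨hx, hy⟩ := hrun4 t h4 (by omega)
    clear hR0 hrun1 hrun2 hrun3 hrun4 hrun5 hrun6 hrun7 hR8
    have hk1 : ¬ (t + 1 ≤ 2 * k) := by omega
    have hk2 : ¬ (t ≤ 2 * k + 2 * i + 1) := by omega
    have hk3 : ¬ (t ≤ 2 * k + 2 * i + 2 * j + 4) := by omega
    have hk4 : ¬ (t + 1 ≤ 4 * k) := by omega
    have hk5 : t ≤ 4 * k + 2 * d + 1 := by omega
    rw [hx, hy, if_neg hk1, if_neg hk1, if_neg hk2, if_neg hk2, if_neg hk3, if_neg hk3, if_neg hk4, if_neg hk4,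
        if_pos hk5, if_pos hk5]
    constructor <;> omega
  rcases Nat.lt_or_ge t (t₆ + 1) with h6 | h6
  · obtain ⟨hx, hy⟩ := hrun5 t h5 (by omega)
    clear hR0 hrun1 hrun2 hrun3 hrun4 hrun5 hrun6 hrun7 hR8
    have hk1 : ¬ (t + 1 ≤ 2 * k) := by omega
    have hk2 : ¬ (t ≤ 2 * k + 2 * i + 1) := by omega
    have hk3 : ¬ (t ≤ 2 * k + 2 * i + 2 * j + 4) := by omega
    have hk4 : ¬ (t + 1 ≤ 4 * k) := by omega
    have hk5 : ¬ (t ≤ 4 * k + 2 * d + 1) := by omega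
    have hk6 : t + 2 * g + 2 ≤ 6 * k := by omega
    rw [hx, hy, if_neg hk1, if_neg hk1, if_neg hk2, if_neg hk2, if_neg hk3, if_neg hk3, if_neg hk4, if_neg hk4,
        if_neg hk5, if_neg hk5, if_pos hk6, if_pos hk6]
    constructor <;> omega
  rcases Nat.lt_or_ge t (t₇ + 1) with h7 | h7
  · obtain ⟨hx, hy⟩ := hrun6 t h6 (by omega)
    clear hR0 hrun1 hrun2 hrun3 hrun4 hrun5 hrun6 hrun7 hR8
    have hk1 : ¬ (t + 1 ≤ 2 * k) := by omega
    have hk2 : ¬ (t ≤ 2 * k + 2 * i + 1) := by omega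
    have hk3 : ¬ (t ≤ 2 * k + 2 * i + 2 * j + 4) := by omega
    have hk4 : ¬ (t + 1 ≤ 4 * k) := by omega
    have hk5 : ¬ (t ≤ 4 * k + 2 * d + 1) := by omega
    have hk6 : ¬ (t + 2 * g + 2 ≤ 6 * k) := by omega
    have hk7 : t ≤ 6 * k := by omega
    rw [hx, hy, if_neg hk1, if_neg hk1, if_neg hk2, if_neg hk2, if_neg hk3, if_neg hk3, if_neg hk4, if_neg hk4,
        if_neg hk5, if_neg hk5, if_neg hk6, if_neg hk6, if_pos hk7, if_pos hk7]
    constructor <;> omega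
  rcases Nat.lt_or_ge t (t₈ + 1) with h8 | h8
  · obtain ⟨hx, hy⟩ := hrun7 t h7 (by omega)
    clear hR0 hrun1 hrun2 hrun3 hrun4 hrun5 hrun6 hrun7 hR8
    have hk1 : ¬ (t + 1 ≤ 2 * k) := by omega
    have hk2 : ¬ (t ≤ 2 * k + 2 * i + 1) := by omega
    have hk3 : ¬ (t ≤ 2 * k + 2 * i + 2 * j + 4) := by omega
    have hk4 : ¬ (t + 1 ≤ 4 * k) := by omega
    have hk5 : ¬ (t ≤ 4 * k + 2 * d + 1) := by omega
    have hk6 : ¬ (t + 2 * g + 2 ≤ 6 * k) := by omega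
    have hk7 : ¬ (t ≤ 6 * k) := by omega
    have hk8 : t ≤ 6 * k + 2 := by omega
    rw [hx, hy, if_neg hk1, if_neg hk1, if_neg hk2, if_neg hk2, if_neg hk3, if_neg hk3, if_neg hk4, if_neg hk4,
        if_neg hk5, if_neg hk5, if_neg hk6, if_neg hk6, if_neg hk7, if_neg hk7, if_pos hk8, if_pos hk8]
    constructor <;> omega
  obtain ⟨hx, hy⟩ := hR8 t h8 ht
  clear hR0 hrun1 hrun2 hrun3 hrun4 hrun5 hrun6 hrun7 hR8
  have hk1 : ¬ (t + 1 ≤ 2 * k) := by omega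
  have hk2 : ¬ (t ≤ 2 * k + 2 * i + 1) := by omega
  have hk3 : ¬ (t ≤ 2 * k + 2 * i + 2 * j + 4) := by omega
  have hk4 : ¬ (t + 1 ≤ 4 * k) := by omega
  have hk5 : ¬ (t ≤ 4 * k + 2 * d + 1) := by omega
  have hk6 : ¬ (t + 2 * g + 2 ≤ 6 * k) := by omega
  have hk7 : ¬ (t ≤ 6 * k) := by omega
  have hk8 : ¬ (t ≤ 6 * k + 2) := by omega
  rw [hx, hy, if_neg hk1, if_neg hk1, if_neg hk2, if_neg hk2, if_neg hk3, if_neg hk3, if_neg hk4, if_neg hk4,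
      if_neg hk5, if_neg hk5, if_neg hk6, if_neg hk6, if_neg hk7, if_neg hk7, if_neg hk8, if_neg hk8]
  constructor <;> omega

/-! ### §4  Identification: runs + system + table disjunct ⇒ the block is the table walk, in `ddddBlocks k` -/
/-- **A `D D D U D U U U` block satisfying system A11 lies in `ddddBlocks k` — it IS a table walk `s4e`.** The signs
`L R R R R L L` of the seven body runs are forced by the system against the run end columns; the parities of
`p, h₁ … h₇` give the half variables; the step times are then those of the table, so `ddduduuu4_table_e` and
`eq_tab_walk_of_forall` identify the walk, and `s4e_mem_ddddBlocks` places it. Inputs: the runs of `ddduduuu4_runs`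
(`…SlackFourFourDownRuns`), the system `Ddduduuu4Hyp` (`…SlackFourFourDownHyp`, produced by `…Systems`) and the A11
disjunct `hF` of `ddduduuu4_int_table` (`…IntTableDDDUDUUU`).
[cite: MadrasSlade1993, §4.2, Definition 4.2.1 (p. 90), remark before (4.2.21) (p. 94)]
[cite: EntingJensen2009, §7.4.2, Fig. 7.10] -/
theorem ddduduuu4_eq_s4e {k m p₁ p₂ p₃ p₄ r₁ r₂ r₃ r₄ c1 c2 c3 c4 c5 c6 c7 p f h1 h2 h3 h4 h5 h6 h7 : ℕ}
    {e₁ e₂ e₃ e₄ e₅ e₆ e₇ : ℤ}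
    (hm : m = 6 * k + 4) (hs : ω ∈ saws m) (hR0 : ∀ i, i ≤ p₁ → ω i 0 = i ∧ ω i 1 = 0) (he₁ : e₁ = 1 ∨ e₁ = -1)
    (he₂ : e₂ = 1 ∨ e₂ = -1) (he₃ : e₃ = 1 ∨ e₃ = -1) (he₄ : e₄ = 1 ∨ e₄ = -1) (he₅ : e₅ = 1 ∨ e₅ = -1)
    (he₆ : e₆ = 1 ∨ e₆ = -1) (he₇ : e₇ = 1 ∨ e₇ = -1)
    (hrun1 : ∀ i, p₁ + 1 ≤ i → i ≤ p₂ → ω i 0 = p₁ + e₁ * ((i - (p₁ + 1) : ℕ) : ℤ) ∧ ω i 1 = -1)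
    (hrun2 : ∀ i, p₂ + 1 ≤ i → i ≤ p₃ → ω i 0 = ω p₂ 0 + e₂ * ((i - (p₂ + 1) : ℕ) : ℤ) ∧ ω i 1 = -2)
    (hrun3 : ∀ i, p₃ + 1 ≤ i → i ≤ r₁ → ω i 0 = ω p₃ 0 + e₃ * ((i - (p₃ + 1) : ℕ) : ℤ) ∧ ω i 1 = -3)
    (hrun4 : ∀ i, r₁ + 1 ≤ i → i ≤ p₄ → ω i 0 = ω r₁ 0 + e₄ * ((i - (r₁ + 1) : ℕ) : ℤ) ∧ ω i 1 = -2)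
    (hrun5 : ∀ i, p₄ + 1 ≤ i → i ≤ r₂ → ω i 0 = ω p₄ 0 + e₅ * ((i - (p₄ + 1) : ℕ) : ℤ) ∧ ω i 1 = -3)
    (hrun6 : ∀ i, r₂ + 1 ≤ i → i ≤ r₃ → ω i 0 = ω r₂ 0 + e₆ * ((i - (r₂ + 1) : ℕ) : ℤ) ∧ ω i 1 = -2)
    (hrun7 : ∀ i, r₃ + 1 ≤ i → i ≤ r₄ → ω i 0 = ω r₃ 0 + e₇ * ((i - (r₃ + 1) : ℕ) : ℤ) ∧ ω i 1 = -1)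
    (hR8 : ∀ j, r₄ + 1 ≤ j → j ≤ m → ω j 0 = ω r₄ 0 + ((j - (r₄ + 1) : ℕ) : ℤ) ∧ ω j 1 = 0) (hC1 : (c1 : ℤ) = ω p₂ 0)
    (hC2 : (c2 : ℤ) = ω p₃ 0) (hC3 : (c3 : ℤ) = ω r₁ 0) (hC4 : (c4 : ℤ) = ω p₄ 0) (hC5 : (c5 : ℤ) = ω r₂ 0)
    (hC6 : (c6 : ℤ) = ω r₃ 0) (hC7 : (c7 : ℤ) = ω r₄ 0)
    (H : Ddduduuu4Hyp k p f h1 h2 h3 h4 h5 h6 h7 c1 c2 c3 c4 c5 c6 c7) (hp : p = p₁) (hf : f = m - r₄ - 1)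
    (hh1 : h1 = p₂ - p₁ - 1) (hh2 : h2 = p₃ - p₂ - 1) (hh3 : h3 = r₁ - p₃ - 1) (hh4 : h4 = p₄ - r₁ - 1)
    (hh5 : h5 = r₂ - p₄ - 1) (hh6 : h6 = r₃ - r₂ - 1) (hh7 : h7 = r₄ - r₃ - 1)
    (hF :
      c1 + h1 = p ∧ c2 = c1 + h2 ∧ c3 = c2 + h3 ∧ c4 = c3 + h4 ∧ c5 = c4 + h5 ∧ c6 + h6 = c5 ∧ c7 + h7 = c6 ∧
      h1 + 2 = p ∧ h2 + h3 + h4 + h5 + 1 = 2 * k ∧ p + h6 + h7 + 1 = 2 * k ∧ p + f = 2 * k ∧ 3 ≤ p ∧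
      h2 + h3 + h4 + h6 + 2 ≤ 2 * k ∧ p + h6 + 2 ≤ 2 * k) :
    ω ∈ ddddBlocks k ∧ ∃ a i j d g : ℕ, ω = s4e k a i j d g := by
  subst hm
  have Hh1 := H.hh1; have Hh2 := H.hh2; have Hh3 := H.hh3; have Hh4 := H.hh4; have Hh5 := H.hh5; have Hh6 := H.hh6
  have Hh7 := H.hh7
  -- half variables from the parities
  obtain ⟨a0, ha0⟩ : ∃ a, p = 2 * a + 1 := ⟨p / 2, by have := H.hpp; clear * - this; omega⟩
  obtain ⟨d1, hd1⟩ : ∃ d, h1 = 2 * d + 1 := ⟨h1 / 2, by have := H.hp1; clear * - this; omega⟩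
  obtain ⟨d2, hd2⟩ : ∃ d, h2 = 2 * d + 1 := ⟨h2 / 2, by have := H.hp2; clear * - this; omega⟩
  obtain ⟨d3, hd3⟩ : ∃ d, h3 = 2 * d := ⟨h3 / 2, by have := H.hp3; clear * - this; omega⟩
  obtain ⟨d4, hd4⟩ : ∃ d, h4 = 2 * d := ⟨h4 / 2, by have := H.hp4; clear * - this; omega⟩
  obtain ⟨d5, hd5⟩ : ∃ d, h5 = 2 * d := ⟨h5 / 2, by have := H.hp5; clear * - this; omega⟩
  obtain ⟨d6, hd6⟩ : ∃ d, h6 = 2 * d + 1 := ⟨h6 / 2, by have := H.hp6; clear * - this; omega⟩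
  obtain ⟨d7, hd7⟩ : ∃ d, h7 = 2 * d + 1 := ⟨h7 / 2, by have := H.hp7; clear * - this; omega⟩
  -- additive forms of the run lengths (no truncated subtraction reaches `omega` below)
  have hf' : r₄ + f + 1 = 6 * k + 4 := by have := H.hf; clear * - this hf; omega
  have hh1' : p₁ + h1 + 1 = p₂ := by clear * - hh1 Hh1; omega
  have hh2' : p₂ + h2 + 1 = p₃ := by clear * - hh2 Hh2; omega
  have hh3' : p₃ + h3 + 1 = r₁ := by clear * - hh3 Hh3; omega
  have hh4' : r₁ + h4 + 1 = p₄ := by clear * - hh4 Hh4; omega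
  have hh5' : p₄ + h5 + 1 = r₂ := by clear * - hh5 Hh5; omega
  have hh6' : r₂ + h6 + 1 = r₃ := by clear * - hh6 Hh6; omega
  have hh7' : r₃ + h7 + 1 = r₄ := by clear * - hh7 Hh7; omega
  clear hf hh1 hh2 hh3 hh4 hh5 hh6 hh7
  -- end columns of the seven body runs
  have hb1 := (hrun1 p₂ (by clear * - hh1'; omega) le_rfl).1
  have hb2 := (hrun2 p₃ (by clear * - hh2'; omega) le_rfl).1
  have hb3 := (hrun3 r₁ (by clear * - hh3'; omega) le_rfl).1
  have hb4 := (hrun4 p₄ (by clear * - hh4'; omega) le_rfl).1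
  have hb5 := (hrun5 r₂ (by clear * - hh5'; omega) le_rfl).1
  have hb6 := (hrun6 r₃ (by clear * - hh6'; omega) le_rfl).1
  have hb7 := (hrun7 r₄ (by clear * - hh7'; omega) le_rfl).1
  -- the signs are forced by the system
  have E1 : e₁ = -1 := by
    clear * - he₁ hb1 hC1 hF hh1' Hh1 hp
    rcases he₁ with h | h
    · exfalso; rw [h] at hb1; omega
    · exact h
  subst E1
  have E2 : e₂ = 1 := by
    clear * - he₂ hb2 hC1 hC2 hF hh2' Hh2 hp
    rcases he₂ with h | h
    · exact h
    · exfalso; rw [h] at hb2; omega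
  subst E2
  have E3 : e₃ = 1 := by
    clear * - he₃ hb3 hC2 hC3 hF hh3' Hh3 hp
    rcases he₃ with h | h
    · exact h
    · exfalso; rw [h] at hb3; omega
  subst E3
  have E4 : e₄ = 1 := by
    clear * - he₄ hb4 hC3 hC4 hF hh4' Hh4 hp
    rcases he₄ with h | h
    · exact h
    · exfalso; rw [h] at hb4; omega
  subst E4
  have E5 : e₅ = 1 := by
    clear * - he₅ hb5 hC4 hC5 hF hh5' Hh5 hp
    rcases he₅ with h | h
    · exact h
    · exfalso; rw [h] at hb5; omega
  subst E5
  have E6 : e₆ = -1 := by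
    clear * - he₆ hb6 hC5 hC6 hF hh6' Hh6 hp
    rcases he₆ with h | h
    · exfalso; rw [h] at hb6; omega
    · exact h
  subst E6
  have E7 : e₇ = -1 := by
    clear * - he₇ hb7 hC6 hC7 hF hh7' Hh7 hp
    rcases he₇ with h | h
    · exfalso; rw [h] at hb7; omega
    · exact h
  subst E7
  clear hb1 hb2 hb3 hb4 hb5 hb6 hb7 hC1 hC2 hC3 hC4 hC5 hC6 hC7
  -- the step times and the family hypotheses in the half variables (linear part of the system only)
  obtain ⟨-, -, -, -, -, -, -, L1, L2, L3, L4, L5, L6, L7⟩ := hF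
  obtain ⟨j0, hj0⟩ : ∃ x, x + 1 = d3 := ⟨d3 - (1), by
    clear * - L1 L2 L3 L4 L5 L6 L7 hp hf' hh1' hh2' hh3' hh4' hh5' hh6' hh7' ha0 hd1 hd2 hd3 hd4 hd5 hd6 hd7 Hh1 Hh2
        Hh3 Hh4 Hh5 Hh6 Hh7
    omega⟩
  obtain ⟨d0, hd0⟩ : ∃ x, x + 1 = d4 := ⟨d4 - (1), by
    clear * - L1 L2 L3 L4 L5 L6 L7 hp hf' hh1' hh2' hh3' hh4' hh5' hh6' hh7' ha0 hd1 hd2 hd3 hd4 hd5 hd6 hd7 Hh1 Hh2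
        Hh3 Hh4 Hh5 Hh6 Hh7 hj0
    omega⟩
  have hq1 : p₁ = 2 * a0 + 1 := by
    clear * - L1 L2 L3 L4 L5 L6 L7 hp hf' hh1' hh2' hh3' hh4' hh5' hh6' hh7' ha0 hd1 hd2 hd3 hd4 hd5 hd6 hd7 Hh1 Hh2
        Hh3 Hh4 Hh5 Hh6 Hh7 hj0 hd0; omega
  have hq2 : p₂ = 4 * a0 + 1 := by
    clear * - L1 L2 L3 L4 L5 L6 L7 hp hf' hh1' hh2' hh3' hh4' hh5' hh6' hh7' ha0 hd1 hd2 hd3 hd4 hd5 hd6 hd7 Hh1 Hh2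
        Hh3 Hh4 Hh5 Hh6 Hh7 hj0 hd0; omega
  have hq3 : p₃ = 4 * a0 + 2 * d2 + 3 := by
    clear * - L1 L2 L3 L4 L5 L6 L7 hp hf' hh1' hh2' hh3' hh4' hh5' hh6' hh7' ha0 hd1 hd2 hd3 hd4 hd5 hd6 hd7 Hh1 Hh2
        Hh3 Hh4 Hh5 Hh6 Hh7 hj0 hd0; omega
  have hq4 : r₁ = 4 * a0 + 2 * d2 + 2 * j0 + 6 := by
    clear * - L1 L2 L3 L4 L5 L6 L7 hp hf' hh1' hh2' hh3' hh4' hh5' hh6' hh7' ha0 hd1 hd2 hd3 hd4 hd5 hd6 hd7 Hh1 Hh2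
        Hh3 Hh4 Hh5 Hh6 Hh7 hj0 hd0; omega
  have hq5 : p₄ = 4 * a0 + 2 * d2 + 2 * j0 + 2 * d0 + 9 := by
    clear * - L1 L2 L3 L4 L5 L6 L7 hp hf' hh1' hh2' hh3' hh4' hh5' hh6' hh7' ha0 hd1 hd2 hd3 hd4 hd5 hd6 hd7 Hh1 Hh2
        Hh3 Hh4 Hh5 Hh6 Hh7 hj0 hd0; omega
  have hq6 : r₂ = 2 * k + 4 * a0 + 4 := by
    clear * - L1 L2 L3 L4 L5 L6 L7 hp hf' hh1' hh2' hh3' hh4' hh5' hh6' hh7' ha0 hd1 hd2 hd3 hd4 hd5 hd6 hd7 Hh1 Hh2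
        Hh3 Hh4 Hh5 Hh6 Hh7 hj0 hd0; omega
  have hq7 : r₃ = 2 * k + 4 * a0 + 2 * d6 + 6 := by
    clear * - L1 L2 L3 L4 L5 L6 L7 hp hf' hh1' hh2' hh3' hh4' hh5' hh6' hh7' ha0 hd1 hd2 hd3 hd4 hd5 hd6 hd7 Hh1 Hh2
        Hh3 Hh4 Hh5 Hh6 Hh7 hj0 hd0; omega
  have hq8 : r₄ = 4 * k + 2 * a0 + 4 := by
    clear * - L1 L2 L3 L4 L5 L6 L7 hp hf' hh1' hh2' hh3' hh4' hh5' hh6' hh7' ha0 hd1 hd2 hd3 hd4 hd5 hd6 hd7 Hh1 Hh2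
        Hh3 Hh4 Hh5 Hh6 Hh7 hj0 hd0; omega
  have hG1 : 1 ≤ a0 := by
    clear * - L1 L2 L3 L4 L5 L6 L7 hp hf' hh1' hh2' hh3' hh4' hh5' hh6' hh7' ha0 hd1 hd2 hd3 hd4 hd5 hd6 hd7 Hh1 Hh2
        Hh3 Hh4 Hh5 Hh6 Hh7 hj0 hd0; omega
  have hG2 : d2 + j0 + d0 + d6 + 4 ≤ k := by
    clear * - L1 L2 L3 L4 L5 L6 L7 hp hf' hh1' hh2' hh3' hh4' hh5' hh6' hh7' ha0 hd1 hd2 hd3 hd4 hd5 hd6 hd7 Hh1 Hh2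
        Hh3 Hh4 Hh5 Hh6 Hh7 hj0 hd0; omega
  have hG3 : a0 + d6 + 2 ≤ k := by
    clear * - L1 L2 L3 L4 L5 L6 L7 hp hf' hh1' hh2' hh3' hh4' hh5' hh6' hh7' ha0 hd1 hd2 hd3 hd4 hd5 hd6 hd7 Hh1 Hh2
        Hh3 Hh4 Hh5 Hh6 Hh7 hj0 hd0; omega
  have heq : ω = s4e k a0 d2 j0 d0 d6 :=
    eq_tab_walk_of_forall hs
        (ddduduuu4_table_e (k := k) (p := p₁) (t₂ := p₂) (t₃ := p₃) (t₄ := r₁) (t₅ := p₄) (t₆ := r₂) (t₇ := r₃)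
            (t₈ := r₄) (a := a0) (i := d2) (j := j0) (d := d0) (g := d6) hG1 hG2 hG3 hR0 hrun1 hrun2 hrun3 hrun4
            hrun5 hrun6 hrun7 hR8 hq1 hq2 hq3 hq4 hq5 hq6 hq7 hq8)
  refine ⟨?_, _, _, _, _, _, heq⟩
  rw [heq]
  exact s4e_mem_ddddBlocks hG1 hG2 hG3

/-- **A `D D D U D U U U` block satisfying system A12 lies in `ddddBlocks k` — it IS a table walk `s4f`.** The signs
`L R R R R R R` of the seven body runs are forced by the system against the run end columns; the parities of
`p, h₁ … h₇` give the half variables; the step times are then those of the table, so `ddduduuu4_table_f` and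
`eq_tab_walk_of_forall` identify the walk, and `s4f_mem_ddddBlocks` places it. Inputs: the runs of `ddduduuu4_runs`
(`…SlackFourFourDownRuns`), the system `Ddduduuu4Hyp` (`…SlackFourFourDownHyp`, produced by `…Systems`) and the A12
disjunct `hF` of `ddduduuu4_int_table` (`…IntTableDDDUDUUU`).
[cite: MadrasSlade1993, §4.2, Definition 4.2.1 (p. 90), remark before (4.2.21) (p. 94)]
[cite: EntingJensen2009, §7.4.2, Fig. 7.10] -/
theorem ddduduuu4_eq_s4f {k m p₁ p₂ p₃ p₄ r₁ r₂ r₃ r₄ c1 c2 c3 c4 c5 c6 c7 p f h1 h2 h3 h4 h5 h6 h7 : ℕ}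
    {e₁ e₂ e₃ e₄ e₅ e₆ e₇ : ℤ}
    (hm : m = 6 * k + 4) (hs : ω ∈ saws m) (hR0 : ∀ i, i ≤ p₁ → ω i 0 = i ∧ ω i 1 = 0) (he₁ : e₁ = 1 ∨ e₁ = -1)
    (he₂ : e₂ = 1 ∨ e₂ = -1) (he₃ : e₃ = 1 ∨ e₃ = -1) (he₄ : e₄ = 1 ∨ e₄ = -1) (he₅ : e₅ = 1 ∨ e₅ = -1)
    (he₆ : e₆ = 1 ∨ e₆ = -1) (he₇ : e₇ = 1 ∨ e₇ = -1)
    (hrun1 : ∀ i, p₁ + 1 ≤ i → i ≤ p₂ → ω i 0 = p₁ + e₁ * ((i - (p₁ + 1) : ℕ) : ℤ) ∧ ω i 1 = -1)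
    (hrun2 : ∀ i, p₂ + 1 ≤ i → i ≤ p₃ → ω i 0 = ω p₂ 0 + e₂ * ((i - (p₂ + 1) : ℕ) : ℤ) ∧ ω i 1 = -2)
    (hrun3 : ∀ i, p₃ + 1 ≤ i → i ≤ r₁ → ω i 0 = ω p₃ 0 + e₃ * ((i - (p₃ + 1) : ℕ) : ℤ) ∧ ω i 1 = -3)
    (hrun4 : ∀ i, r₁ + 1 ≤ i → i ≤ p₄ → ω i 0 = ω r₁ 0 + e₄ * ((i - (r₁ + 1) : ℕ) : ℤ) ∧ ω i 1 = -2)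
    (hrun5 : ∀ i, p₄ + 1 ≤ i → i ≤ r₂ → ω i 0 = ω p₄ 0 + e₅ * ((i - (p₄ + 1) : ℕ) : ℤ) ∧ ω i 1 = -3)
    (hrun6 : ∀ i, r₂ + 1 ≤ i → i ≤ r₃ → ω i 0 = ω r₂ 0 + e₆ * ((i - (r₂ + 1) : ℕ) : ℤ) ∧ ω i 1 = -2)
    (hrun7 : ∀ i, r₃ + 1 ≤ i → i ≤ r₄ → ω i 0 = ω r₃ 0 + e₇ * ((i - (r₃ + 1) : ℕ) : ℤ) ∧ ω i 1 = -1)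
    (hR8 : ∀ j, r₄ + 1 ≤ j → j ≤ m → ω j 0 = ω r₄ 0 + ((j - (r₄ + 1) : ℕ) : ℤ) ∧ ω j 1 = 0) (hC1 : (c1 : ℤ) = ω p₂ 0)
    (hC2 : (c2 : ℤ) = ω p₃ 0) (hC3 : (c3 : ℤ) = ω r₁ 0) (hC4 : (c4 : ℤ) = ω p₄ 0) (hC5 : (c5 : ℤ) = ω r₂ 0)
    (hC6 : (c6 : ℤ) = ω r₃ 0) (hC7 : (c7 : ℤ) = ω r₄ 0)
    (H : Ddduduuu4Hyp k p f h1 h2 h3 h4 h5 h6 h7 c1 c2 c3 c4 c5 c6 c7) (hp : p = p₁) (hf : f = m - r₄ - 1)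
    (hh1 : h1 = p₂ - p₁ - 1) (hh2 : h2 = p₃ - p₂ - 1) (hh3 : h3 = r₁ - p₃ - 1) (hh4 : h4 = p₄ - r₁ - 1)
    (hh5 : h5 = r₂ - p₄ - 1) (hh6 : h6 = r₃ - r₂ - 1) (hh7 : h7 = r₄ - r₃ - 1)
    (hF :
      c1 + h1 = p ∧ c2 = c1 + h2 ∧ c3 = c2 + h3 ∧ c4 = c3 + h4 ∧ c5 = c4 + h5 ∧ c6 = c5 + h6 ∧ c7 = c6 + h7 ∧
      p + 1 = 2 * k ∧ h1 + 3 = 2 * k ∧ h2 + h3 + h4 + h5 + h6 + 2 = 2 * k ∧ h7 = 1 ∧ f = 1 ∧ 2 ≤ h5) :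
    ω ∈ ddddBlocks k ∧ ∃ i j d g : ℕ, ω = s4f k i j d g := by
  subst hm
  have Hh1 := H.hh1; have Hh2 := H.hh2; have Hh3 := H.hh3; have Hh4 := H.hh4; have Hh5 := H.hh5; have Hh6 := H.hh6
  have Hh7 := H.hh7
  -- half variables from the parities
  obtain ⟨a0, ha0⟩ : ∃ a, p = 2 * a + 1 := ⟨p / 2, by have := H.hpp; clear * - this; omega⟩
  obtain ⟨d1, hd1⟩ : ∃ d, h1 = 2 * d + 1 := ⟨h1 / 2, by have := H.hp1; clear * - this; omega⟩
  obtain ⟨d2, hd2⟩ : ∃ d, h2 = 2 * d + 1 := ⟨h2 / 2, by have := H.hp2; clear * - this; omega⟩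
  obtain ⟨d3, hd3⟩ : ∃ d, h3 = 2 * d := ⟨h3 / 2, by have := H.hp3; clear * - this; omega⟩
  obtain ⟨d4, hd4⟩ : ∃ d, h4 = 2 * d := ⟨h4 / 2, by have := H.hp4; clear * - this; omega⟩
  obtain ⟨d5, hd5⟩ : ∃ d, h5 = 2 * d := ⟨h5 / 2, by have := H.hp5; clear * - this; omega⟩
  obtain ⟨d6, hd6⟩ : ∃ d, h6 = 2 * d + 1 := ⟨h6 / 2, by have := H.hp6; clear * - this; omega⟩
  obtain ⟨d7, hd7⟩ : ∃ d, h7 = 2 * d + 1 := ⟨h7 / 2, by have := H.hp7; clear * - this; omega⟩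
  -- additive forms of the run lengths (no truncated subtraction reaches `omega` below)
  have hf' : r₄ + f + 1 = 6 * k + 4 := by have := H.hf; clear * - this hf; omega
  have hh1' : p₁ + h1 + 1 = p₂ := by clear * - hh1 Hh1; omega
  have hh2' : p₂ + h2 + 1 = p₃ := by clear * - hh2 Hh2; omega
  have hh3' : p₃ + h3 + 1 = r₁ := by clear * - hh3 Hh3; omega
  have hh4' : r₁ + h4 + 1 = p₄ := by clear * - hh4 Hh4; omega
  have hh5' : p₄ + h5 + 1 = r₂ := by clear * - hh5 Hh5; omega
  have hh6' : r₂ + h6 + 1 = r₃ := by clear * - hh6 Hh6; omega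
  have hh7' : r₃ + h7 + 1 = r₄ := by clear * - hh7 Hh7; omega
  clear hf hh1 hh2 hh3 hh4 hh5 hh6 hh7
  -- end columns of the seven body runs
  have hb1 := (hrun1 p₂ (by clear * - hh1'; omega) le_rfl).1
  have hb2 := (hrun2 p₃ (by clear * - hh2'; omega) le_rfl).1
  have hb3 := (hrun3 r₁ (by clear * - hh3'; omega) le_rfl).1
  have hb4 := (hrun4 p₄ (by clear * - hh4'; omega) le_rfl).1
  have hb5 := (hrun5 r₂ (by clear * - hh5'; omega) le_rfl).1
  have hb6 := (hrun6 r₃ (by clear * - hh6'; omega) le_rfl).1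
  have hb7 := (hrun7 r₄ (by clear * - hh7'; omega) le_rfl).1
  -- the signs are forced by the system
  have E1 : e₁ = -1 := by
    clear * - he₁ hb1 hC1 hF hh1' Hh1 hp
    rcases he₁ with h | h
    · exfalso; rw [h] at hb1; omega
    · exact h
  subst E1
  have E2 : e₂ = 1 := by
    clear * - he₂ hb2 hC1 hC2 hF hh2' Hh2 hp
    rcases he₂ with h | h
    · exact h
    · exfalso; rw [h] at hb2; omega
  subst E2
  have E3 : e₃ = 1 := by
    clear * - he₃ hb3 hC2 hC3 hF hh3' Hh3 hp
    rcases he₃ with h | h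
    · exact h
    · exfalso; rw [h] at hb3; omega
  subst E3
  have E4 : e₄ = 1 := by
    clear * - he₄ hb4 hC3 hC4 hF hh4' Hh4 hp
    rcases he₄ with h | h
    · exact h
    · exfalso; rw [h] at hb4; omega
  subst E4
  have E5 : e₅ = 1 := by
    clear * - he₅ hb5 hC4 hC5 hF hh5' Hh5 hp
    rcases he₅ with h | h
    · exact h
    · exfalso; rw [h] at hb5; omega
  subst E5
  have E6 : e₆ = 1 := by
    clear * - he₆ hb6 hC5 hC6 hF hh6' Hh6 hp
    rcases he₆ with h | h
    · exact h
    · exfalso; rw [h] at hb6; omega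
  subst E6
  have E7 : e₇ = 1 := by
    clear * - he₇ hb7 hC6 hC7 hF hh7' Hh7 hp
    rcases he₇ with h | h
    · exact h
    · exfalso; rw [h] at hb7; omega
  subst E7
  clear hb1 hb2 hb3 hb4 hb5 hb6 hb7 hC1 hC2 hC3 hC4 hC5 hC6 hC7
  -- the step times and the family hypotheses in the half variables (linear part of the system only)
  obtain ⟨-, -, -, -, -, -, -, L1, L2, L3, L4, L5, L6⟩ := hF
  obtain ⟨j0, hj0⟩ : ∃ x, x + 1 = d3 := ⟨d3 - (1), by
    clear * - L1 L2 L3 L4 L5 L6 hp hf' hh1' hh2' hh3' hh4' hh5' hh6' hh7' ha0 hd1 hd2 hd3 hd4 hd5 hd6 hd7 Hh1 Hh2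
        Hh3 Hh4 Hh5 Hh6 Hh7
    omega⟩
  obtain ⟨d0, hd0⟩ : ∃ x, x + 1 = d4 := ⟨d4 - (1), by
    clear * - L1 L2 L3 L4 L5 L6 hp hf' hh1' hh2' hh3' hh4' hh5' hh6' hh7' ha0 hd1 hd2 hd3 hd4 hd5 hd6 hd7 Hh1 Hh2
        Hh3 Hh4 Hh5 Hh6 Hh7 hj0
    omega⟩
  obtain ⟨g0, hg0⟩ : ∃ x, x + d2 + d3 + d4 + d5 + 2 = k := ⟨k - (d2 + d3 + d4 + d5 + 2), by
    clear * - L1 L2 L3 L4 L5 L6 hp hf' hh1' hh2' hh3' hh4' hh5' hh6' hh7' ha0 hd1 hd2 hd3 hd4 hd5 hd6 hd7 Hh1 Hh2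
        Hh3 Hh4 Hh5 Hh6 Hh7 hj0 hd0
    omega⟩
  have hq1 : p₁ + 1 = 2 * k := by
    clear * - L1 L2 L3 L4 L5 L6 hp hf' hh1' hh2' hh3' hh4' hh5' hh6' hh7' ha0 hd1 hd2 hd3 hd4 hd5 hd6 hd7 Hh1 Hh2 Hh3
        Hh4 Hh5 Hh6 Hh7 hj0 hd0 hg0; omega
  have hq2 : p₂ + 3 = 4 * k := by
    clear * - L1 L2 L3 L4 L5 L6 hp hf' hh1' hh2' hh3' hh4' hh5' hh6' hh7' ha0 hd1 hd2 hd3 hd4 hd5 hd6 hd7 Hh1 Hh2 Hh3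
        Hh4 Hh5 Hh6 Hh7 hj0 hd0 hg0; omega
  have hq3 : p₃ + 1 = 4 * k + 2 * d2 := by
    clear * - L1 L2 L3 L4 L5 L6 hp hf' hh1' hh2' hh3' hh4' hh5' hh6' hh7' ha0 hd1 hd2 hd3 hd4 hd5 hd6 hd7 Hh1 Hh2 Hh3
        Hh4 Hh5 Hh6 Hh7 hj0 hd0 hg0; omega
  have hq4 : r₁ = 4 * k + 2 * d2 + 2 * j0 + 2 := by
    clear * - L1 L2 L3 L4 L5 L6 hp hf' hh1' hh2' hh3' hh4' hh5' hh6' hh7' ha0 hd1 hd2 hd3 hd4 hd5 hd6 hd7 Hh1 Hh2 Hh3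
        Hh4 Hh5 Hh6 Hh7 hj0 hd0 hg0; omega
  have hq5 : p₄ = 4 * k + 2 * d2 + 2 * j0 + 2 * d0 + 5 := by
    clear * - L1 L2 L3 L4 L5 L6 hp hf' hh1' hh2' hh3' hh4' hh5' hh6' hh7' ha0 hd1 hd2 hd3 hd4 hd5 hd6 hd7 Hh1 Hh2 Hh3
        Hh4 Hh5 Hh6 Hh7 hj0 hd0 hg0; omega
  have hq6 : r₂ + 2 * g0 + 2 = 6 * k := by
    clear * - L1 L2 L3 L4 L5 L6 hp hf' hh1' hh2' hh3' hh4' hh5' hh6' hh7' ha0 hd1 hd2 hd3 hd4 hd5 hd6 hd7 Hh1 Hh2 Hh3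
        Hh4 Hh5 Hh6 Hh7 hj0 hd0 hg0; omega
  have hq7 : r₃ = 6 * k := by
    clear * - L1 L2 L3 L4 L5 L6 hp hf' hh1' hh2' hh3' hh4' hh5' hh6' hh7' ha0 hd1 hd2 hd3 hd4 hd5 hd6 hd7 Hh1 Hh2 Hh3
        Hh4 Hh5 Hh6 Hh7 hj0 hd0 hg0; omega
  have hq8 : r₄ = 6 * k + 2 := by
    clear * - L1 L2 L3 L4 L5 L6 hp hf' hh1' hh2' hh3' hh4' hh5' hh6' hh7' ha0 hd1 hd2 hd3 hd4 hd5 hd6 hd7 Hh1 Hh2 Hh3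
        Hh4 Hh5 Hh6 Hh7 hj0 hd0 hg0; omega
  have hG1 : d2 + j0 + d0 + g0 + 5 ≤ k := by
    clear * - L1 L2 L3 L4 L5 L6 hp hf' hh1' hh2' hh3' hh4' hh5' hh6' hh7' ha0 hd1 hd2 hd3 hd4 hd5 hd6 hd7 Hh1 Hh2 Hh3
        Hh4 Hh5 Hh6 Hh7 hj0 hd0 hg0; omega
  have heq : ω = s4f k d2 j0 d0 g0 :=
    eq_tab_walk_of_forall hs
        (ddduduuu4_table_f (k := k) (p := p₁) (t₂ := p₂) (t₃ := p₃) (t₄ := r₁) (t₅ := p₄) (t₆ := r₂) (t₇ := r₃)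
            (t₈ := r₄) (i := d2) (j := j0) (d := d0) (g := g0) hG1 hR0 hrun1 hrun2 hrun3 hrun4 hrun5 hrun6 hrun7
            hR8 hq1 hq2 hq3 hq4 hq5 hq6 hq7 hq8)
  refine ⟨?_, _, _, _, _, heq⟩
  rw [heq]
  exact s4f_mem_ddddBlocks hG1

/-- **A `D D D U U D U U` block satisfying system A13 lies in `ddddBlocks k` — it IS a table walk `s4g`.** The signs
`L R R L L L L` of the seven body runs are forced by the system against the run end columns; the parities of
`p, h₁ … h₇` give the half variables; the step times are then those of the table, so `ddduuduu4_table_g` and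
`eq_tab_walk_of_forall` identify the walk, and `s4g_mem_ddddBlocks` places it. Inputs: the runs of `ddduuduu4_runs`
(`…SlackFourFourDownRuns`), the system `Ddduuduu4Hyp` (`…SlackFourFourDownHyp`, produced by `…Systems`) and the A13
disjunct `hF` of `ddduuduu4_int_table` (`…IntTableDDDUUDUU`).
[cite: MadrasSlade1993, §4.2, Definition 4.2.1 (p. 90), remark before (4.2.21) (p. 94)]
[cite: EntingJensen2009, §7.4.2, Fig. 7.10] -/
theorem ddduuduu4_eq_s4g {k m p₁ p₂ p₃ p₄ r₁ r₂ r₃ r₄ c1 c2 c3 c4 c5 c6 c7 p f h1 h2 h3 h4 h5 h6 h7 : ℕ}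
    {e₁ e₂ e₃ e₄ e₅ e₆ e₇ : ℤ}
    (hm : m = 6 * k + 4) (hs : ω ∈ saws m) (hR0 : ∀ i, i ≤ p₁ → ω i 0 = i ∧ ω i 1 = 0) (he₁ : e₁ = 1 ∨ e₁ = -1)
    (he₂ : e₂ = 1 ∨ e₂ = -1) (he₃ : e₃ = 1 ∨ e₃ = -1) (he₄ : e₄ = 1 ∨ e₄ = -1) (he₅ : e₅ = 1 ∨ e₅ = -1)
    (he₆ : e₆ = 1 ∨ e₆ = -1) (he₇ : e₇ = 1 ∨ e₇ = -1)
    (hrun1 : ∀ i, p₁ + 1 ≤ i → i ≤ p₂ → ω i 0 = p₁ + e₁ * ((i - (p₁ + 1) : ℕ) : ℤ) ∧ ω i 1 = -1)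
    (hrun2 : ∀ i, p₂ + 1 ≤ i → i ≤ p₃ → ω i 0 = ω p₂ 0 + e₂ * ((i - (p₂ + 1) : ℕ) : ℤ) ∧ ω i 1 = -2)
    (hrun3 : ∀ i, p₃ + 1 ≤ i → i ≤ r₁ → ω i 0 = ω p₃ 0 + e₃ * ((i - (p₃ + 1) : ℕ) : ℤ) ∧ ω i 1 = -3)
    (hrun4 : ∀ i, r₁ + 1 ≤ i → i ≤ r₂ → ω i 0 = ω r₁ 0 + e₄ * ((i - (r₁ + 1) : ℕ) : ℤ) ∧ ω i 1 = -2)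
    (hrun5 : ∀ i, r₂ + 1 ≤ i → i ≤ p₄ → ω i 0 = ω r₂ 0 + e₅ * ((i - (r₂ + 1) : ℕ) : ℤ) ∧ ω i 1 = -1)
    (hrun6 : ∀ i, p₄ + 1 ≤ i → i ≤ r₃ → ω i 0 = ω p₄ 0 + e₆ * ((i - (p₄ + 1) : ℕ) : ℤ) ∧ ω i 1 = -2)
    (hrun7 : ∀ i, r₃ + 1 ≤ i → i ≤ r₄ → ω i 0 = ω r₃ 0 + e₇ * ((i - (r₃ + 1) : ℕ) : ℤ) ∧ ω i 1 = -1)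
    (hR8 : ∀ j, r₄ + 1 ≤ j → j ≤ m → ω j 0 = ω r₄ 0 + ((j - (r₄ + 1) : ℕ) : ℤ) ∧ ω j 1 = 0) (hC1 : (c1 : ℤ) = ω p₂ 0)
    (hC2 : (c2 : ℤ) = ω p₃ 0) (hC3 : (c3 : ℤ) = ω r₁ 0) (hC4 : (c4 : ℤ) = ω r₂ 0) (hC5 : (c5 : ℤ) = ω p₄ 0)
    (hC6 : (c6 : ℤ) = ω r₃ 0) (hC7 : (c7 : ℤ) = ω r₄ 0)
    (H : Ddduuduu4Hyp k p f h1 h2 h3 h4 h5 h6 h7 c1 c2 c3 c4 c5 c6 c7) (hp : p = p₁) (hf : f = m - r₄ - 1)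
    (hh1 : h1 = p₂ - p₁ - 1) (hh2 : h2 = p₃ - p₂ - 1) (hh3 : h3 = r₁ - p₃ - 1) (hh4 : h4 = r₂ - r₁ - 1)
    (hh5 : h5 = p₄ - r₂ - 1) (hh6 : h6 = r₃ - p₄ - 1) (hh7 : h7 = r₄ - r₃ - 1)
    (hF :
      c1 + h1 = p ∧ c2 = c1 + h2 ∧ c3 = c2 + h3 ∧ c4 + h4 = c3 ∧ c5 + h5 = c4 ∧ c6 + h6 = c5 ∧ c7 + h7 = c6 ∧
      h1 + 2 = p ∧ h2 + h3 + 1 = 2 * k ∧ p + h4 + h5 + h6 + h7 + 1 = 2 * k ∧ p + f = 2 * k ∧ 3 ≤ p ∧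
      p + h4 + h5 + h6 + 2 ≤ 2 * k ∧ h2 + h4 + h5 + h6 + 2 ≤ 2 * k) :
    ω ∈ ddddBlocks k ∧ ∃ a i d e g : ℕ, ω = s4g k a i d e g := by
  subst hm
  have Hh1 := H.hh1; have Hh2 := H.hh2; have Hh3 := H.hh3; have Hh4 := H.hh4; have Hh5 := H.hh5; have Hh6 := H.hh6
  have Hh7 := H.hh7
  -- half variables from the parities
  obtain ⟨a0, ha0⟩ : ∃ a, p = 2 * a + 1 := ⟨p / 2, by have := H.hpp; clear * - this; omega⟩
  obtain ⟨d1, hd1⟩ : ∃ d, h1 = 2 * d + 1 := ⟨h1 / 2, by have := H.hp1; clear * - this; omega⟩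
  obtain ⟨d2, hd2⟩ : ∃ d, h2 = 2 * d + 1 := ⟨h2 / 2, by have := H.hp2; clear * - this; omega⟩
  obtain ⟨d3, hd3⟩ : ∃ d, h3 = 2 * d := ⟨h3 / 2, by have := H.hp3; clear * - this; omega⟩
  obtain ⟨d4, hd4⟩ : ∃ d, h4 = 2 * d + 1 := ⟨h4 / 2, by have := H.hp4; clear * - this; omega⟩
  obtain ⟨d5, hd5⟩ : ∃ d, h5 = 2 * d := ⟨h5 / 2, by have := H.hp5; clear * - this; omega⟩
  obtain ⟨d6, hd6⟩ : ∃ d, h6 = 2 * d := ⟨h6 / 2, by have := H.hp6; clear * - this; omega⟩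
  obtain ⟨d7, hd7⟩ : ∃ d, h7 = 2 * d + 1 := ⟨h7 / 2, by have := H.hp7; clear * - this; omega⟩
  -- additive forms of the run lengths (no truncated subtraction reaches `omega` below)
  have hf' : r₄ + f + 1 = 6 * k + 4 := by have := H.hf; clear * - this hf; omega
  have hh1' : p₁ + h1 + 1 = p₂ := by clear * - hh1 Hh1; omega
  have hh2' : p₂ + h2 + 1 = p₃ := by clear * - hh2 Hh2; omega
  have hh3' : p₃ + h3 + 1 = r₁ := by clear * - hh3 Hh3; omega
  have hh4' : r₁ + h4 + 1 = r₂ := by clear * - hh4 Hh4; omega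
  have hh5' : r₂ + h5 + 1 = p₄ := by clear * - hh5 Hh5; omega
  have hh6' : p₄ + h6 + 1 = r₃ := by clear * - hh6 Hh6; omega
  have hh7' : r₃ + h7 + 1 = r₄ := by clear * - hh7 Hh7; omega
  clear hf hh1 hh2 hh3 hh4 hh5 hh6 hh7
  -- end columns of the seven body runs
  have hb1 := (hrun1 p₂ (by clear * - hh1'; omega) le_rfl).1
  have hb2 := (hrun2 p₃ (by clear * - hh2'; omega) le_rfl).1
  have hb3 := (hrun3 r₁ (by clear * - hh3'; omega) le_rfl).1
  have hb4 := (hrun4 r₂ (by clear * - hh4'; omega) le_rfl).1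
  have hb5 := (hrun5 p₄ (by clear * - hh5'; omega) le_rfl).1
  have hb6 := (hrun6 r₃ (by clear * - hh6'; omega) le_rfl).1
  have hb7 := (hrun7 r₄ (by clear * - hh7'; omega) le_rfl).1
  -- the signs are forced by the system
  have E1 : e₁ = -1 := by
    clear * - he₁ hb1 hC1 hF hh1' Hh1 hp
    rcases he₁ with h | h
    · exfalso; rw [h] at hb1; omega
    · exact h
  subst E1
  have E2 : e₂ = 1 := by
    clear * - he₂ hb2 hC1 hC2 hF hh2' Hh2 hp
    rcases he₂ with h | h
    · exact h
    · exfalso; rw [h] at hb2; omega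
  subst E2
  have E3 : e₃ = 1 := by
    clear * - he₃ hb3 hC2 hC3 hF hh3' Hh3 hp
    rcases he₃ with h | h
    · exact h
    · exfalso; rw [h] at hb3; omega
  subst E3
  have E4 : e₄ = -1 := by
    clear * - he₄ hb4 hC3 hC4 hF hh4' Hh4 hp
    rcases he₄ with h | h
    · exfalso; rw [h] at hb4; omega
    · exact h
  subst E4
  have E5 : e₅ = -1 := by
    clear * - he₅ hb5 hC4 hC5 hF hh5' Hh5 hp
    rcases he₅ with h | h
    · exfalso; rw [h] at hb5; omega
    · exact h
  subst E5
  have E6 : e₆ = -1 := by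
    clear * - he₆ hb6 hC5 hC6 hF hh6' Hh6 hp
    rcases he₆ with h | h
    · exfalso; rw [h] at hb6; omega
    · exact h
  subst E6
  have E7 : e₇ = -1 := by
    clear * - he₇ hb7 hC6 hC7 hF hh7' Hh7 hp
    rcases he₇ with h | h
    · exfalso; rw [h] at hb7; omega
    · exact h
  subst E7
  clear hb1 hb2 hb3 hb4 hb5 hb6 hb7 hC1 hC2 hC3 hC4 hC5 hC6 hC7
  -- the step times and the family hypotheses in the half variables (linear part of the system only)
  obtain ⟨-, -, -, -, -, -, -, L1, L2, L3, L4, L5, L6, L7⟩ := hF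
  obtain ⟨e0, he0⟩ : ∃ x, x + 1 = d5 := ⟨d5 - (1), by
    clear * - L1 L2 L3 L4 L5 L6 L7 hp hf' hh1' hh2' hh3' hh4' hh5' hh6' hh7' ha0 hd1 hd2 hd3 hd4 hd5 hd6 hd7 Hh1 Hh2
        Hh3 Hh4 Hh5 Hh6 Hh7
    omega⟩
  obtain ⟨g0, hg0⟩ : ∃ x, x + 1 = d6 := ⟨d6 - (1), by
    clear * - L1 L2 L3 L4 L5 L6 L7 hp hf' hh1' hh2' hh3' hh4' hh5' hh6' hh7' ha0 hd1 hd2 hd3 hd4 hd5 hd6 hd7 Hh1 Hh2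
        Hh3 Hh4 Hh5 Hh6 Hh7 he0
    omega⟩
  have hq1 : p₁ = 2 * a0 + 1 := by
    clear * - L1 L2 L3 L4 L5 L6 L7 hp hf' hh1' hh2' hh3' hh4' hh5' hh6' hh7' ha0 hd1 hd2 hd3 hd4 hd5 hd6 hd7 Hh1 Hh2
        Hh3 Hh4 Hh5 Hh6 Hh7 he0 hg0; omega
  have hq2 : p₂ = 4 * a0 + 1 := by
    clear * - L1 L2 L3 L4 L5 L6 L7 hp hf' hh1' hh2' hh3' hh4' hh5' hh6' hh7' ha0 hd1 hd2 hd3 hd4 hd5 hd6 hd7 Hh1 Hh2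
        Hh3 Hh4 Hh5 Hh6 Hh7 he0 hg0; omega
  have hq3 : p₃ = 4 * a0 + 2 * d2 + 3 := by
    clear * - L1 L2 L3 L4 L5 L6 L7 hp hf' hh1' hh2' hh3' hh4' hh5' hh6' hh7' ha0 hd1 hd2 hd3 hd4 hd5 hd6 hd7 Hh1 Hh2
        Hh3 Hh4 Hh5 Hh6 Hh7 he0 hg0; omega
  have hq4 : r₁ = 2 * k + 4 * a0 + 2 := by
    clear * - L1 L2 L3 L4 L5 L6 L7 hp hf' hh1' hh2' hh3' hh4' hh5' hh6' hh7' ha0 hd1 hd2 hd3 hd4 hd5 hd6 hd7 Hh1 Hh2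
        Hh3 Hh4 Hh5 Hh6 Hh7 he0 hg0; omega
  have hq5 : r₂ = 2 * k + 4 * a0 + 2 * d4 + 4 := by
    clear * - L1 L2 L3 L4 L5 L6 L7 hp hf' hh1' hh2' hh3' hh4' hh5' hh6' hh7' ha0 hd1 hd2 hd3 hd4 hd5 hd6 hd7 Hh1 Hh2
        Hh3 Hh4 Hh5 Hh6 Hh7 he0 hg0; omega
  have hq6 : p₄ = 2 * k + 4 * a0 + 2 * d4 + 2 * e0 + 7 := by
    clear * - L1 L2 L3 L4 L5 L6 L7 hp hf' hh1' hh2' hh3' hh4' hh5' hh6' hh7' ha0 hd1 hd2 hd3 hd4 hd5 hd6 hd7 Hh1 Hh2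
        Hh3 Hh4 Hh5 Hh6 Hh7 he0 hg0; omega
  have hq7 : r₃ = 2 * k + 4 * a0 + 2 * d4 + 2 * e0 + 2 * g0 + 10 := by
    clear * - L1 L2 L3 L4 L5 L6 L7 hp hf' hh1' hh2' hh3' hh4' hh5' hh6' hh7' ha0 hd1 hd2 hd3 hd4 hd5 hd6 hd7 Hh1 Hh2
        Hh3 Hh4 Hh5 Hh6 Hh7 he0 hg0; omega
  have hq8 : r₄ = 4 * k + 2 * a0 + 4 := by
    clear * - L1 L2 L3 L4 L5 L6 L7 hp hf' hh1' hh2' hh3' hh4' hh5' hh6' hh7' ha0 hd1 hd2 hd3 hd4 hd5 hd6 hd7 Hh1 Hh2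
        Hh3 Hh4 Hh5 Hh6 Hh7 he0 hg0; omega
  have hG1 : 1 ≤ a0 := by
    clear * - L1 L2 L3 L4 L5 L6 L7 hp hf' hh1' hh2' hh3' hh4' hh5' hh6' hh7' ha0 hd1 hd2 hd3 hd4 hd5 hd6 hd7 Hh1 Hh2
        Hh3 Hh4 Hh5 Hh6 Hh7 he0 hg0; omega
  have hG2 : a0 + d4 + e0 + g0 + 4 ≤ k := by
    clear * - L1 L2 L3 L4 L5 L6 L7 hp hf' hh1' hh2' hh3' hh4' hh5' hh6' hh7' ha0 hd1 hd2 hd3 hd4 hd5 hd6 hd7 Hh1 Hh2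
        Hh3 Hh4 Hh5 Hh6 Hh7 he0 hg0; omega
  have hG3 : d2 + d4 + e0 + g0 + 4 ≤ k := by
    clear * - L1 L2 L3 L4 L5 L6 L7 hp hf' hh1' hh2' hh3' hh4' hh5' hh6' hh7' ha0 hd1 hd2 hd3 hd4 hd5 hd6 hd7 Hh1 Hh2
        Hh3 Hh4 Hh5 Hh6 Hh7 he0 hg0; omega
  have heq : ω = s4g k a0 d2 d4 e0 g0 :=
    eq_tab_walk_of_forall hs
        (ddduuduu4_table_g (k := k) (p := p₁) (t₂ := p₂) (t₃ := p₃) (t₄ := r₁) (t₅ := r₂) (t₆ := p₄) (t₇ := r₃)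
            (t₈ := r₄) (a := a0) (i := d2) (d := d4) (e := e0) (g := g0) hG1 hG2 hG3 hR0 hrun1 hrun2 hrun3 hrun4
            hrun5 hrun6 hrun7 hR8 hq1 hq2 hq3 hq4 hq5 hq6 hq7 hq8)
  refine ⟨?_, _, _, _, _, _, heq⟩
  rw [heq]
  exact s4g_mem_ddddBlocks hG1 hG2 hG3

/-- **A `D D U D D U U U` block satisfying system A14 lies in `ddddBlocks k` — it IS a table walk `s4h`.** The signs
`L L L R R L L` of the seven body runs are forced by the system against the run end columns; the parities of
`p, h₁ … h₇` give the half variables; the step times are then those of the table, so `ddudduuu4_table_h` and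
`eq_tab_walk_of_forall` identify the walk, and `s4h_mem_ddddBlocks` places it. Inputs: the runs of `ddudduuu4_runs`
(`…SlackFourFourDownRuns`), the system `Ddudduuu4Hyp` (`…SlackFourFourDownHyp`, produced by `…Systems`) and the A14
disjunct `hF` of `ddudduuu4_int_table` (`…IntTableDDUDDUUU`).
[cite: MadrasSlade1993, §4.2, Definition 4.2.1 (p. 90), remark before (4.2.21) (p. 94)]
[cite: EntingJensen2009, §7.4.2, Fig. 7.10] -/
theorem ddudduuu4_eq_s4h {k m p₁ p₂ p₃ p₄ r₁ r₂ r₃ r₄ c1 c2 c3 c4 c5 c6 c7 p f h1 h2 h3 h4 h5 h6 h7 : ℕ}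
    {e₁ e₂ e₃ e₄ e₅ e₆ e₇ : ℤ}
    (hm : m = 6 * k + 4) (hs : ω ∈ saws m) (hR0 : ∀ i, i ≤ p₁ → ω i 0 = i ∧ ω i 1 = 0) (he₁ : e₁ = 1 ∨ e₁ = -1)
    (he₂ : e₂ = 1 ∨ e₂ = -1) (he₃ : e₃ = 1 ∨ e₃ = -1) (he₄ : e₄ = 1 ∨ e₄ = -1) (he₅ : e₅ = 1 ∨ e₅ = -1)
    (he₆ : e₆ = 1 ∨ e₆ = -1) (he₇ : e₇ = 1 ∨ e₇ = -1)
    (hrun1 : ∀ i, p₁ + 1 ≤ i → i ≤ p₂ → ω i 0 = p₁ + e₁ * ((i - (p₁ + 1) : ℕ) : ℤ) ∧ ω i 1 = -1)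
    (hrun2 : ∀ i, p₂ + 1 ≤ i → i ≤ r₁ → ω i 0 = ω p₂ 0 + e₂ * ((i - (p₂ + 1) : ℕ) : ℤ) ∧ ω i 1 = -2)
    (hrun3 : ∀ i, r₁ + 1 ≤ i → i ≤ p₃ → ω i 0 = ω r₁ 0 + e₃ * ((i - (r₁ + 1) : ℕ) : ℤ) ∧ ω i 1 = -1)
    (hrun4 : ∀ i, p₃ + 1 ≤ i → i ≤ p₄ → ω i 0 = ω p₃ 0 + e₄ * ((i - (p₃ + 1) : ℕ) : ℤ) ∧ ω i 1 = -2)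
    (hrun5 : ∀ i, p₄ + 1 ≤ i → i ≤ r₂ → ω i 0 = ω p₄ 0 + e₅ * ((i - (p₄ + 1) : ℕ) : ℤ) ∧ ω i 1 = -3)
    (hrun6 : ∀ i, r₂ + 1 ≤ i → i ≤ r₃ → ω i 0 = ω r₂ 0 + e₆ * ((i - (r₂ + 1) : ℕ) : ℤ) ∧ ω i 1 = -2)
    (hrun7 : ∀ i, r₃ + 1 ≤ i → i ≤ r₄ → ω i 0 = ω r₃ 0 + e₇ * ((i - (r₃ + 1) : ℕ) : ℤ) ∧ ω i 1 = -1)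
    (hR8 : ∀ j, r₄ + 1 ≤ j → j ≤ m → ω j 0 = ω r₄ 0 + ((j - (r₄ + 1) : ℕ) : ℤ) ∧ ω j 1 = 0) (hC1 : (c1 : ℤ) = ω p₂ 0)
    (hC2 : (c2 : ℤ) = ω r₁ 0) (hC3 : (c3 : ℤ) = ω p₃ 0) (hC4 : (c4 : ℤ) = ω p₄ 0) (hC5 : (c5 : ℤ) = ω r₂ 0)
    (hC6 : (c6 : ℤ) = ω r₃ 0) (hC7 : (c7 : ℤ) = ω r₄ 0)
    (H : Ddudduuu4Hyp k p f h1 h2 h3 h4 h5 h6 h7 c1 c2 c3 c4 c5 c6 c7) (hp : p = p₁) (hf : f = m - r₄ - 1)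
    (hh1 : h1 = p₂ - p₁ - 1) (hh2 : h2 = r₁ - p₂ - 1) (hh3 : h3 = p₃ - r₁ - 1) (hh4 : h4 = p₄ - p₃ - 1)
    (hh5 : h5 = r₂ - p₄ - 1) (hh6 : h6 = r₃ - r₂ - 1) (hh7 : h7 = r₄ - r₃ - 1)
    (hF :
      c1 + h1 = p ∧ c2 + h2 = c1 ∧ c3 + h3 = c2 ∧ c4 = c3 + h4 ∧ c5 = c4 + h5 ∧ c6 + h6 = c5 ∧ c7 + h7 = c6 ∧
      h1 + h2 + h3 + 2 = p ∧ h4 + h5 + 1 = 2 * k ∧ p + h6 + h7 + 1 = 2 * k ∧ p + f = 2 * k ∧ h1 + h2 + h4 + 3 ≤ p ∧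
      p + h6 + 2 ≤ 2 * k) :
    ω ∈ ddddBlocks k ∧ ∃ a i j d g : ℕ, ω = s4h k a i j d g := by
  subst hm
  have Hh1 := H.hh1; have Hh2 := H.hh2; have Hh3 := H.hh3; have Hh4 := H.hh4; have Hh5 := H.hh5; have Hh6 := H.hh6
  have Hh7 := H.hh7
  -- half variables from the parities
  obtain ⟨a0, ha0⟩ : ∃ a, p = 2 * a + 1 := ⟨p / 2, by have := H.hpp; clear * - this; omega⟩
  obtain ⟨d1, hd1⟩ : ∃ d, h1 = 2 * d + 1 := ⟨h1 / 2, by have := H.hp1; clear * - this; omega⟩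
  obtain ⟨d2, hd2⟩ : ∃ d, h2 = 2 * d := ⟨h2 / 2, by have := H.hp2; clear * - this; omega⟩
  obtain ⟨d3, hd3⟩ : ∃ d, h3 = 2 * d := ⟨h3 / 2, by have := H.hp3; clear * - this; omega⟩
  obtain ⟨d4, hd4⟩ : ∃ d, h4 = 2 * d + 1 := ⟨h4 / 2, by have := H.hp4; clear * - this; omega⟩
  obtain ⟨d5, hd5⟩ : ∃ d, h5 = 2 * d := ⟨h5 / 2, by have := H.hp5; clear * - this; omega⟩
  obtain ⟨d6, hd6⟩ : ∃ d, h6 = 2 * d + 1 := ⟨h6 / 2, by have := H.hp6; clear * - this; omega⟩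
  obtain ⟨d7, hd7⟩ : ∃ d, h7 = 2 * d + 1 := ⟨h7 / 2, by have := H.hp7; clear * - this; omega⟩
  -- additive forms of the run lengths (no truncated subtraction reaches `omega` below)
  have hf' : r₄ + f + 1 = 6 * k + 4 := by have := H.hf; clear * - this hf; omega
  have hh1' : p₁ + h1 + 1 = p₂ := by clear * - hh1 Hh1; omega
  have hh2' : p₂ + h2 + 1 = r₁ := by clear * - hh2 Hh2; omega
  have hh3' : r₁ + h3 + 1 = p₃ := by clear * - hh3 Hh3; omega
  have hh4' : p₃ + h4 + 1 = p₄ := by clear * - hh4 Hh4; omega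
  have hh5' : p₄ + h5 + 1 = r₂ := by clear * - hh5 Hh5; omega
  have hh6' : r₂ + h6 + 1 = r₃ := by clear * - hh6 Hh6; omega
  have hh7' : r₃ + h7 + 1 = r₄ := by clear * - hh7 Hh7; omega
  clear hf hh1 hh2 hh3 hh4 hh5 hh6 hh7
  -- end columns of the seven body runs
  have hb1 := (hrun1 p₂ (by clear * - hh1'; omega) le_rfl).1
  have hb2 := (hrun2 r₁ (by clear * - hh2'; omega) le_rfl).1
  have hb3 := (hrun3 p₃ (by clear * - hh3'; omega) le_rfl).1
  have hb4 := (hrun4 p₄ (by clear * - hh4'; omega) le_rfl).1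
  have hb5 := (hrun5 r₂ (by clear * - hh5'; omega) le_rfl).1
  have hb6 := (hrun6 r₃ (by clear * - hh6'; omega) le_rfl).1
  have hb7 := (hrun7 r₄ (by clear * - hh7'; omega) le_rfl).1
  -- the signs are forced by the system
  have E1 : e₁ = -1 := by
    clear * - he₁ hb1 hC1 hF hh1' Hh1 hp
    rcases he₁ with h | h
    · exfalso; rw [h] at hb1; omega
    · exact h
  subst E1
  have E2 : e₂ = -1 := by
    clear * - he₂ hb2 hC1 hC2 hF hh2' Hh2 hp
    rcases he₂ with h | h
    · exfalso; rw [h] at hb2; omega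
    · exact h
  subst E2
  have E3 : e₃ = -1 := by
    clear * - he₃ hb3 hC2 hC3 hF hh3' Hh3 hp
    rcases he₃ with h | h
    · exfalso; rw [h] at hb3; omega
    · exact h
  subst E3
  have E4 : e₄ = 1 := by
    clear * - he₄ hb4 hC3 hC4 hF hh4' Hh4 hp
    rcases he₄ with h | h
    · exact h
    · exfalso; rw [h] at hb4; omega
  subst E4
  have E5 : e₅ = 1 := by
    clear * - he₅ hb5 hC4 hC5 hF hh5' Hh5 hp
    rcases he₅ with h | h
    · exact h
    · exfalso; rw [h] at hb5; omega
  subst E5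
  have E6 : e₆ = -1 := by
    clear * - he₆ hb6 hC5 hC6 hF hh6' Hh6 hp
    rcases he₆ with h | h
    · exfalso; rw [h] at hb6; omega
    · exact h
  subst E6
  have E7 : e₇ = -1 := by
    clear * - he₇ hb7 hC6 hC7 hF hh7' Hh7 hp
    rcases he₇ with h | h
    · exfalso; rw [h] at hb7; omega
    · exact h
  subst E7
  clear hb1 hb2 hb3 hb4 hb5 hb6 hb7 hC1 hC2 hC3 hC4 hC5 hC6 hC7
  -- the step times and the family hypotheses in the half variables (linear part of the system only)
  obtain ⟨-, -, -, -, -, -, -, L1, L2, L3, L4, L5, L6⟩ := hF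
  obtain ⟨j0, hj0⟩ : ∃ x, x + 1 = d2 := ⟨d2 - (1), by
    clear * - L1 L2 L3 L4 L5 L6 hp hf' hh1' hh2' hh3' hh4' hh5' hh6' hh7' ha0 hd1 hd2 hd3 hd4 hd5 hd6 hd7 Hh1 Hh2
        Hh3 Hh4 Hh5 Hh6 Hh7
    omega⟩
  have hq1 : p₁ = 2 * a0 + 1 := by
    clear * - L1 L2 L3 L4 L5 L6 hp hf' hh1' hh2' hh3' hh4' hh5' hh6' hh7' ha0 hd1 hd2 hd3 hd4 hd5 hd6 hd7 Hh1 Hh2 Hh3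
        Hh4 Hh5 Hh6 Hh7 hj0; omega
  have hq2 : p₂ = 2 * a0 + 2 * d1 + 3 := by
    clear * - L1 L2 L3 L4 L5 L6 hp hf' hh1' hh2' hh3' hh4' hh5' hh6' hh7' ha0 hd1 hd2 hd3 hd4 hd5 hd6 hd7 Hh1 Hh2 Hh3
        Hh4 Hh5 Hh6 Hh7 hj0; omega
  have hq3 : r₁ = 2 * a0 + 2 * d1 + 2 * j0 + 6 := by
    clear * - L1 L2 L3 L4 L5 L6 hp hf' hh1' hh2' hh3' hh4' hh5' hh6' hh7' ha0 hd1 hd2 hd3 hd4 hd5 hd6 hd7 Hh1 Hh2 Hh3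
        Hh4 Hh5 Hh6 Hh7 hj0; omega
  have hq4 : p₃ = 4 * a0 + 3 := by
    clear * - L1 L2 L3 L4 L5 L6 hp hf' hh1' hh2' hh3' hh4' hh5' hh6' hh7' ha0 hd1 hd2 hd3 hd4 hd5 hd6 hd7 Hh1 Hh2 Hh3
        Hh4 Hh5 Hh6 Hh7 hj0; omega
  have hq5 : p₄ = 4 * a0 + 2 * d4 + 5 := by
    clear * - L1 L2 L3 L4 L5 L6 hp hf' hh1' hh2' hh3' hh4' hh5' hh6' hh7' ha0 hd1 hd2 hd3 hd4 hd5 hd6 hd7 Hh1 Hh2 Hh3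
        Hh4 Hh5 Hh6 Hh7 hj0; omega
  have hq6 : r₂ = 2 * k + 4 * a0 + 4 := by
    clear * - L1 L2 L3 L4 L5 L6 hp hf' hh1' hh2' hh3' hh4' hh5' hh6' hh7' ha0 hd1 hd2 hd3 hd4 hd5 hd6 hd7 Hh1 Hh2 Hh3
        Hh4 Hh5 Hh6 Hh7 hj0; omega
  have hq7 : r₃ = 2 * k + 4 * a0 + 2 * d6 + 6 := by
    clear * - L1 L2 L3 L4 L5 L6 hp hf' hh1' hh2' hh3' hh4' hh5' hh6' hh7' ha0 hd1 hd2 hd3 hd4 hd5 hd6 hd7 Hh1 Hh2 Hh3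
        Hh4 Hh5 Hh6 Hh7 hj0; omega
  have hq8 : r₄ = 4 * k + 2 * a0 + 4 := by
    clear * - L1 L2 L3 L4 L5 L6 hp hf' hh1' hh2' hh3' hh4' hh5' hh6' hh7' ha0 hd1 hd2 hd3 hd4 hd5 hd6 hd7 Hh1 Hh2 Hh3
        Hh4 Hh5 Hh6 Hh7 hj0; omega
  have hG1 : d1 + j0 + d4 + 3 ≤ a0 := by
    clear * - L1 L2 L3 L4 L5 L6 hp hf' hh1' hh2' hh3' hh4' hh5' hh6' hh7' ha0 hd1 hd2 hd3 hd4 hd5 hd6 hd7 Hh1 Hh2 Hh3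
        Hh4 Hh5 Hh6 Hh7 hj0; omega
  have hG2 : a0 + d6 + 2 ≤ k := by
    clear * - L1 L2 L3 L4 L5 L6 hp hf' hh1' hh2' hh3' hh4' hh5' hh6' hh7' ha0 hd1 hd2 hd3 hd4 hd5 hd6 hd7 Hh1 Hh2 Hh3
        Hh4 Hh5 Hh6 Hh7 hj0; omega
  have heq : ω = s4h k a0 d1 j0 d4 d6 :=
    eq_tab_walk_of_forall hs
        (ddudduuu4_table_h (k := k) (p := p₁) (t₂ := p₂) (t₃ := r₁) (t₄ := p₃) (t₅ := p₄) (t₆ := r₂) (t₇ := r₃)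
            (t₈ := r₄) (a := a0) (i := d1) (j := j0) (d := d4) (g := d6) hG1 hG2 hR0 hrun1 hrun2 hrun3 hrun4 hrun5
            hrun6 hrun7 hR8 hq1 hq2 hq3 hq4 hq5 hq6 hq7 hq8)
  refine ⟨?_, _, _, _, _, _, heq⟩
  rw [heq]
  exact s4h_mem_ddddBlocks hG1 hG2

/-- **A `D D U D D U U U` block satisfying system A15 lies in `ddddBlocks k` — it IS a table walk `s4i`.** The signs
`L L L R R R R` of the seven body runs are forced by the system against the run end columns; the parities of
`p, h₁ … h₇` give the half variables; the step times are then those of the table, so `ddudduuu4_table_i` and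
`eq_tab_walk_of_forall` identify the walk, and `s4i_mem_ddddBlocks` places it. Inputs: the runs of `ddudduuu4_runs`
(`…SlackFourFourDownRuns`), the system `Ddudduuu4Hyp` (`…SlackFourFourDownHyp`, produced by `…Systems`) and the A15
disjunct `hF` of `ddudduuu4_int_table` (`…IntTableDDUDDUUU`).
[cite: MadrasSlade1993, §4.2, Definition 4.2.1 (p. 90), remark before (4.2.21) (p. 94)]
[cite: EntingJensen2009, §7.4.2, Fig. 7.10] -/
theorem ddudduuu4_eq_s4i {k m p₁ p₂ p₃ p₄ r₁ r₂ r₃ r₄ c1 c2 c3 c4 c5 c6 c7 p f h1 h2 h3 h4 h5 h6 h7 : ℕ}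
    {e₁ e₂ e₃ e₄ e₅ e₆ e₇ : ℤ}
    (hm : m = 6 * k + 4) (hs : ω ∈ saws m) (hR0 : ∀ i, i ≤ p₁ → ω i 0 = i ∧ ω i 1 = 0) (he₁ : e₁ = 1 ∨ e₁ = -1)
    (he₂ : e₂ = 1 ∨ e₂ = -1) (he₃ : e₃ = 1 ∨ e₃ = -1) (he₄ : e₄ = 1 ∨ e₄ = -1) (he₅ : e₅ = 1 ∨ e₅ = -1)
    (he₆ : e₆ = 1 ∨ e₆ = -1) (he₇ : e₇ = 1 ∨ e₇ = -1)
    (hrun1 : ∀ i, p₁ + 1 ≤ i → i ≤ p₂ → ω i 0 = p₁ + e₁ * ((i - (p₁ + 1) : ℕ) : ℤ) ∧ ω i 1 = -1)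
    (hrun2 : ∀ i, p₂ + 1 ≤ i → i ≤ r₁ → ω i 0 = ω p₂ 0 + e₂ * ((i - (p₂ + 1) : ℕ) : ℤ) ∧ ω i 1 = -2)
    (hrun3 : ∀ i, r₁ + 1 ≤ i → i ≤ p₃ → ω i 0 = ω r₁ 0 + e₃ * ((i - (r₁ + 1) : ℕ) : ℤ) ∧ ω i 1 = -1)
    (hrun4 : ∀ i, p₃ + 1 ≤ i → i ≤ p₄ → ω i 0 = ω p₃ 0 + e₄ * ((i - (p₃ + 1) : ℕ) : ℤ) ∧ ω i 1 = -2)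
    (hrun5 : ∀ i, p₄ + 1 ≤ i → i ≤ r₂ → ω i 0 = ω p₄ 0 + e₅ * ((i - (p₄ + 1) : ℕ) : ℤ) ∧ ω i 1 = -3)
    (hrun6 : ∀ i, r₂ + 1 ≤ i → i ≤ r₃ → ω i 0 = ω r₂ 0 + e₆ * ((i - (r₂ + 1) : ℕ) : ℤ) ∧ ω i 1 = -2)
    (hrun7 : ∀ i, r₃ + 1 ≤ i → i ≤ r₄ → ω i 0 = ω r₃ 0 + e₇ * ((i - (r₃ + 1) : ℕ) : ℤ) ∧ ω i 1 = -1)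
    (hR8 : ∀ j, r₄ + 1 ≤ j → j ≤ m → ω j 0 = ω r₄ 0 + ((j - (r₄ + 1) : ℕ) : ℤ) ∧ ω j 1 = 0) (hC1 : (c1 : ℤ) = ω p₂ 0)
    (hC2 : (c2 : ℤ) = ω r₁ 0) (hC3 : (c3 : ℤ) = ω p₃ 0) (hC4 : (c4 : ℤ) = ω p₄ 0) (hC5 : (c5 : ℤ) = ω r₂ 0)
    (hC6 : (c6 : ℤ) = ω r₃ 0) (hC7 : (c7 : ℤ) = ω r₄ 0)
    (H : Ddudduuu4Hyp k p f h1 h2 h3 h4 h5 h6 h7 c1 c2 c3 c4 c5 c6 c7) (hp : p = p₁) (hf : f = m - r₄ - 1)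
    (hh1 : h1 = p₂ - p₁ - 1) (hh2 : h2 = r₁ - p₂ - 1) (hh3 : h3 = p₃ - r₁ - 1) (hh4 : h4 = p₄ - p₃ - 1)
    (hh5 : h5 = r₂ - p₄ - 1) (hh6 : h6 = r₃ - r₂ - 1) (hh7 : h7 = r₄ - r₃ - 1)
    (hF :
      c1 + h1 = p ∧ c2 + h2 = c1 ∧ c3 + h3 = c2 ∧ c4 = c3 + h4 ∧ c5 = c4 + h5 ∧ c6 = c5 + h6 ∧ c7 = c6 + h7 ∧
      p + 1 = 2 * k ∧ h1 + h2 + h3 + 3 = 2 * k ∧ h4 + h5 + h6 + 2 = 2 * k ∧ h7 = 1 ∧ f = 1 ∧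
      h1 + h2 + h4 + 4 ≤ 2 * k ∧ 2 * k ≤ h1 + h4 + h5 + 2) :
    ω ∈ ddddBlocks k ∧ ∃ i j d g : ℕ, ω = s4i k i j d g := by
  subst hm
  have Hh1 := H.hh1; have Hh2 := H.hh2; have Hh3 := H.hh3; have Hh4 := H.hh4; have Hh5 := H.hh5; have Hh6 := H.hh6
  have Hh7 := H.hh7
  -- half variables from the parities
  obtain ⟨a0, ha0⟩ : ∃ a, p = 2 * a + 1 := ⟨p / 2, by have := H.hpp; clear * - this; omega⟩
  obtain ⟨d1, hd1⟩ : ∃ d, h1 = 2 * d + 1 := ⟨h1 / 2, by have := H.hp1; clear * - this; omega⟩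
  obtain ⟨d2, hd2⟩ : ∃ d, h2 = 2 * d := ⟨h2 / 2, by have := H.hp2; clear * - this; omega⟩
  obtain ⟨d3, hd3⟩ : ∃ d, h3 = 2 * d := ⟨h3 / 2, by have := H.hp3; clear * - this; omega⟩
  obtain ⟨d4, hd4⟩ : ∃ d, h4 = 2 * d + 1 := ⟨h4 / 2, by have := H.hp4; clear * - this; omega⟩
  obtain ⟨d5, hd5⟩ : ∃ d, h5 = 2 * d := ⟨h5 / 2, by have := H.hp5; clear * - this; omega⟩
  obtain ⟨d6, hd6⟩ : ∃ d, h6 = 2 * d + 1 := ⟨h6 / 2, by have := H.hp6; clear * - this; omega⟩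
  obtain ⟨d7, hd7⟩ : ∃ d, h7 = 2 * d + 1 := ⟨h7 / 2, by have := H.hp7; clear * - this; omega⟩
  -- additive forms of the run lengths (no truncated subtraction reaches `omega` below)
  have hf' : r₄ + f + 1 = 6 * k + 4 := by have := H.hf; clear * - this hf; omega
  have hh1' : p₁ + h1 + 1 = p₂ := by clear * - hh1 Hh1; omega
  have hh2' : p₂ + h2 + 1 = r₁ := by clear * - hh2 Hh2; omega
  have hh3' : r₁ + h3 + 1 = p₃ := by clear * - hh3 Hh3; omega
  have hh4' : p₃ + h4 + 1 = p₄ := by clear * - hh4 Hh4; omega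
  have hh5' : p₄ + h5 + 1 = r₂ := by clear * - hh5 Hh5; omega
  have hh6' : r₂ + h6 + 1 = r₃ := by clear * - hh6 Hh6; omega
  have hh7' : r₃ + h7 + 1 = r₄ := by clear * - hh7 Hh7; omega
  clear hf hh1 hh2 hh3 hh4 hh5 hh6 hh7
  -- end columns of the seven body runs
  have hb1 := (hrun1 p₂ (by clear * - hh1'; omega) le_rfl).1
  have hb2 := (hrun2 r₁ (by clear * - hh2'; omega) le_rfl).1
  have hb3 := (hrun3 p₃ (by clear * - hh3'; omega) le_rfl).1
  have hb4 := (hrun4 p₄ (by clear * - hh4'; omega) le_rfl).1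
  have hb5 := (hrun5 r₂ (by clear * - hh5'; omega) le_rfl).1
  have hb6 := (hrun6 r₃ (by clear * - hh6'; omega) le_rfl).1
  have hb7 := (hrun7 r₄ (by clear * - hh7'; omega) le_rfl).1
  -- the signs are forced by the system
  have E1 : e₁ = -1 := by
    clear * - he₁ hb1 hC1 hF hh1' Hh1 hp
    rcases he₁ with h | h
    · exfalso; rw [h] at hb1; omega
    · exact h
  subst E1
  have E2 : e₂ = -1 := by
    clear * - he₂ hb2 hC1 hC2 hF hh2' Hh2 hp
    rcases he₂ with h | h
    · exfalso; rw [h] at hb2; omega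
    · exact h
  subst E2
  have E3 : e₃ = -1 := by
    clear * - he₃ hb3 hC2 hC3 hF hh3' Hh3 hp
    rcases he₃ with h | h
    · exfalso; rw [h] at hb3; omega
    · exact h
  subst E3
  have E4 : e₄ = 1 := by
    clear * - he₄ hb4 hC3 hC4 hF hh4' Hh4 hp
    rcases he₄ with h | h
    · exact h
    · exfalso; rw [h] at hb4; omega
  subst E4
  have E5 : e₅ = 1 := by
    clear * - he₅ hb5 hC4 hC5 hF hh5' Hh5 hp
    rcases he₅ with h | h
    · exact h
    · exfalso; rw [h] at hb5; omega
  subst E5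
  have E6 : e₆ = 1 := by
    clear * - he₆ hb6 hC5 hC6 hF hh6' Hh6 hp
    rcases he₆ with h | h
    · exact h
    · exfalso; rw [h] at hb6; omega
  subst E6
  have E7 : e₇ = 1 := by
    clear * - he₇ hb7 hC6 hC7 hF hh7' Hh7 hp
    rcases he₇ with h | h
    · exact h
    · exfalso; rw [h] at hb7; omega
  subst E7
  clear hb1 hb2 hb3 hb4 hb5 hb6 hb7 hC1 hC2 hC3 hC4 hC5 hC6 hC7
  -- the step times and the family hypotheses in the half variables (linear part of the system only)
  obtain ⟨-, -, -, -, -, -, -, L1, L2, L3, L4, L5, L6, L7⟩ := hF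
  obtain ⟨j0, hj0⟩ : ∃ x, x + 1 = d2 := ⟨d2 - (1), by
    clear * - L1 L2 L3 L4 L5 L6 L7 hp hf' hh1' hh2' hh3' hh4' hh5' hh6' hh7' ha0 hd1 hd2 hd3 hd4 hd5 hd6 hd7 Hh1 Hh2
        Hh3 Hh4 Hh5 Hh6 Hh7
    omega⟩
  obtain ⟨g0, hg0⟩ : ∃ x, x + d4 + d5 + 2 = k := ⟨k - (d4 + d5 + 2), by
    clear * - L1 L2 L3 L4 L5 L6 L7 hp hf' hh1' hh2' hh3' hh4' hh5' hh6' hh7' ha0 hd1 hd2 hd3 hd4 hd5 hd6 hd7 Hh1 Hh2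
        Hh3 Hh4 Hh5 Hh6 Hh7 hj0
    omega⟩
  have hq1 : p₁ + 1 = 2 * k := by
    clear * - L1 L2 L3 L4 L5 L6 L7 hp hf' hh1' hh2' hh3' hh4' hh5' hh6' hh7' ha0 hd1 hd2 hd3 hd4 hd5 hd6 hd7 Hh1 Hh2
        Hh3 Hh4 Hh5 Hh6 Hh7 hj0 hg0; omega
  have hq2 : p₂ = 2 * k + 2 * d1 + 1 := by
    clear * - L1 L2 L3 L4 L5 L6 L7 hp hf' hh1' hh2' hh3' hh4' hh5' hh6' hh7' ha0 hd1 hd2 hd3 hd4 hd5 hd6 hd7 Hh1 Hh2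
        Hh3 Hh4 Hh5 Hh6 Hh7 hj0 hg0; omega
  have hq3 : r₁ = 2 * k + 2 * d1 + 2 * j0 + 4 := by
    clear * - L1 L2 L3 L4 L5 L6 L7 hp hf' hh1' hh2' hh3' hh4' hh5' hh6' hh7' ha0 hd1 hd2 hd3 hd4 hd5 hd6 hd7 Hh1 Hh2
        Hh3 Hh4 Hh5 Hh6 Hh7 hj0 hg0; omega
  have hq4 : p₃ + 1 = 4 * k := by
    clear * - L1 L2 L3 L4 L5 L6 L7 hp hf' hh1' hh2' hh3' hh4' hh5' hh6' hh7' ha0 hd1 hd2 hd3 hd4 hd5 hd6 hd7 Hh1 Hh2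
        Hh3 Hh4 Hh5 Hh6 Hh7 hj0 hg0; omega
  have hq5 : p₄ = 4 * k + 2 * d4 + 1 := by
    clear * - L1 L2 L3 L4 L5 L6 L7 hp hf' hh1' hh2' hh3' hh4' hh5' hh6' hh7' ha0 hd1 hd2 hd3 hd4 hd5 hd6 hd7 Hh1 Hh2
        Hh3 Hh4 Hh5 Hh6 Hh7 hj0 hg0; omega
  have hq6 : r₂ + 2 * g0 + 2 = 6 * k := by
    clear * - L1 L2 L3 L4 L5 L6 L7 hp hf' hh1' hh2' hh3' hh4' hh5' hh6' hh7' ha0 hd1 hd2 hd3 hd4 hd5 hd6 hd7 Hh1 Hh2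
        Hh3 Hh4 Hh5 Hh6 Hh7 hj0 hg0; omega
  have hq7 : r₃ = 6 * k := by
    clear * - L1 L2 L3 L4 L5 L6 L7 hp hf' hh1' hh2' hh3' hh4' hh5' hh6' hh7' ha0 hd1 hd2 hd3 hd4 hd5 hd6 hd7 Hh1 Hh2
        Hh3 Hh4 Hh5 Hh6 Hh7 hj0 hg0; omega
  have hq8 : r₄ = 6 * k + 2 := by
    clear * - L1 L2 L3 L4 L5 L6 L7 hp hf' hh1' hh2' hh3' hh4' hh5' hh6' hh7' ha0 hd1 hd2 hd3 hd4 hd5 hd6 hd7 Hh1 Hh2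
        Hh3 Hh4 Hh5 Hh6 Hh7 hj0 hg0; omega
  have hG1 : d1 + j0 + d4 + 4 ≤ k := by
    clear * - L1 L2 L3 L4 L5 L6 L7 hp hf' hh1' hh2' hh3' hh4' hh5' hh6' hh7' ha0 hd1 hd2 hd3 hd4 hd5 hd6 hd7 Hh1 Hh2
        Hh3 Hh4 Hh5 Hh6 Hh7 hj0 hg0; omega
  have hG2 : g0 ≤ d1 := by
    clear * - L1 L2 L3 L4 L5 L6 L7 hp hf' hh1' hh2' hh3' hh4' hh5' hh6' hh7' ha0 hd1 hd2 hd3 hd4 hd5 hd6 hd7 Hh1 Hh2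
        Hh3 Hh4 Hh5 Hh6 Hh7 hj0 hg0; omega
  have heq : ω = s4i k d1 j0 d4 g0 :=
    eq_tab_walk_of_forall hs
        (ddudduuu4_table_i (k := k) (p := p₁) (t₂ := p₂) (t₃ := r₁) (t₄ := p₃) (t₅ := p₄) (t₆ := r₂) (t₇ := r₃)
            (t₈ := r₄) (i := d1) (j := j0) (d := d4) (g := g0) hG1 hG2 hR0 hrun1 hrun2 hrun3 hrun4 hrun5 hrun6
            hrun7 hR8 hq1 hq2 hq3 hq4 hq5 hq6 hq7 hq8)
  refine ⟨?_, _, _, _, _, heq⟩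
  rw [heq]
  exact s4i_mem_ddddBlocks hG1 hG2

end Literature.Probability.RandomPlanarGeometry.SAW.HexBW.Wall
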